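import Mathlib
import Literature.MathematicalPhysics.QuantumFieldTheory.Balaban1983to89.B6Prop23CubeDepth
import Literature.MathematicalPhysics.QuantumFieldTheory.Balaban1983to89.B6CoverBox
import Literature.MathematicalPhysics.QuantumFieldTheory.Balaban1983to89.B6Lemma21TwoScale
import Literature.MathematicalPhysics.QuantumFieldTheory.Balaban1983to89.B6BoxCharts

/-!
# `Balaban1983to89.B6CoverTwoLevel` — a COORDINATISED TWO-LEVEL MODEL of the cube cover 𝒟 = 𝒟_j ∪ 𝒟_{j+1} and of the
partition of unity {h_□} of (2.36) ACROSS THE INTERFACE ∂Λ_{j+1}: the cover, cube, collar, zone and lattice-sum binders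
of the Proposition 2.3 certificate (`…B6Prop23CubeDepth.prop23_assembled_fine_twoLevel_cubes`) DISCHARGED on a box of
Λ_j glued to a box of Λ_{j+1} (B6 = T. Bałaban, *Propagators and renormalization transformations for lattice gauge
theories. II*, Commun. Math. Phys. **96**, 223–250 (1984) [Balaban1984PropagatorsII]; the profile h is the one of
[B5] = part I, Commun. Math. Phys. **95**, 17–40 (1984) [Balaban1984PropagatorsI], (1.118)).

CITATION HEADER (lean-in-tree rule 2026-08-18).  Cell `pub-balaban`, unit `b2b-balaban-b06-g18` (paper sub-cell B06,
gen 18 — the owner lineage of `…B6Prop23Assembled` ∕ `…B6Prop23DomainInput` ∕ `…B6Prop23TwoLevel` ∕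
`…B6Prop23TwoLevelInputs` ∕ `…B6Prop23CubeDepth` ∕ `…B6CoverBox`, which this NEW LEAF imports and does not modify; it
also imports `…B6Lemma21TwoScale` (the counting lemma `sum_exp_le_c0_pow`, reused BY NAME) and `…B6BoxCharts` (box
charts of a bond graph, `IsBoxChart` ∕ `reachable_of_chart`, reused BY NAME), and reuses BY NAME the profile h = `prof`
and its window identity `sum_prof_sq_eq_one` of the one-level sibling `…B6CoverBox` (gen 17)).  Sources: [B6]
doi:10.1007/bf01240221, held `paper:balaban1984-cmp96-propagators-rt-ii`, journal page = PDF page + 222; the quotations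
of pp. 229, 231, 235, 238 below were read from the page renders `b2b-balaban-ref1/pages/1984-cmp96-propagators-rt-II/
1984-cmp96-propagators-rt-II-p007, p009, p013, p016-x2.png` AS IMAGES this gen; [B5] doi:10.1007/bf01215753, journal
page = PDF page + 16, p. 36 read from `…/1984-cmp95-propagators-rt-I/1984-cmp95-propagators-rt-I-p020-x2.png` AS AN
IMAGE this gen.  Cell rows: GAPS C-b06g18-1 (this module; closes G-pv05-2 = census O-9 on the model), DIVERGENCE
D-b06.38; census `HOME/b2b-balaban-b06-g15/CENSUS-B6-v1.md` §6 hypothesis H-B6.5 (the cover binders) and §7 O-9 (the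
interface matching of (2.36)), which this module addresses; journal claim COVER-TWO-LEVEL.

THE PRINTED TEXT.  [B6] p. 229 [PDF 7]: *"Each set Λ_j is a sum of big blocks of the size ML^jη (Λ_j ⊂ T^{(j)}_{L^jη}),
or of the size M if Λ_j is scaled to unit lattice. We cover B^j(Λ_j) by a sum of cubes □ of the size 2ML^jη, each cube
being a sum of 2^d big blocks with a center y ∈ Λ_j (more exactly it belongs to the boundary of this set also). Taking
these covers for all j from 0 to k we get a family 𝒟 of cubes □ of different sizes and such that T_η = ⋃_{□∈𝒟} □. …
We construct also the corresponding family of functions h described in (1.118), and rescale them to proper scales.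
They satisfy Σ_{□∈𝒟} h_□² = 1. (2.36)"*  [B5] p. 36 [PDF 20], before (1.118): *"h_z(x) = Π_{μ=1}^d h((x_μ − z_μ)∕M₀),
h ∈ C₀^∞(]−⅔, ⅔[), h(t) = 1 for t ∈ [−⅓, ⅓], h is chosen in such a way that Σ_n h²(t − n) = 1, hence Σ_z h_z²(x) = 1.
(1.118)"*  [B6] p. 231 [PDF 9]: *"𝔅 = ⋃_{j=0}^k Λ_j. (2.45) … a part of Γ contained in B^j(Λ_j) consists of bonds of
the lattice Λ_j. Now we define d(y, y′) = inf_{Γ_{y,y′}} Σ_{j=0}^k (L^jη)^{−1}|Γ_{y,y′} ∩ B^j(Λ_j)|, y, y′ ∈ 𝔅, (2.46) …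
Of course the infimum is attained at some contour Γ_{y,y′}."*  [B6] p. 235 [PDF 13]: *"we take a second cube □̃
containing □ in the middle and of the size 4M and we take an inverse of the operator (Q′G′(□̃)²Q′*)↾□ instead of
(Q′G′²Q′*)↾□. … At first let us find bounds on C_□. We assume that either □̃ ⊂ B^j(Λ_j), or it intersects
B^{j+1}(Λ_{j+1}) also."*  [B6] p. 238 [PDF 16], before (2.85): *"An estimate of the terms with the commutator is even
simpler and gives a factor O(M^{−1})."*, then (2.85) |R(y, y′)| ≤ O(M^{−1})e^{−δ₁d(y,y′)}(L^{j′}η)^{−d} and Proposition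
2.3 (2.86)–(2.87).

THE POINT.  The one-level sibling `…B6CoverBox` (gen 17) discharged the cover binders of the Proposition 2.3
certificate on ONE level ("Λ_j scaled to unit lattice").  The printed cover is the UNION over the levels ("Taking these
covers for all j from 0 to k"), (2.36) is asserted for that union, and a cube near ∂Λ_{j+1} has an enlarged cube □̃ that
"intersects B^{j+1}(Λ_{j+1}) also" — but the text does not say how the rescaled families of two adjacent levels are
matched across the interface so that Σ h_□² = 1 still holds there (census O-9 = GAPS G-pv05-2: the plain sum of the two
rescaled (1.118)-families is 2, not 1, where both are complete — certified here as `sqS_corner_eq_two`).  THIS MODULE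
builds a two-level carrier in coordinates — a box {0, …, n_fM}^d of Λ_j-points (unit lattice) and a box of Λ_{j+1}-points
(spacing L ∈ ℕ, L ≥ 2, indices {0, …, n_cM}^d, placed at x₀ ≤ −1) joined by Λ_j-bonds across the face {x₀ = 0} ∕
{x₀ = −1}, with d = the graph distance of the bond graph (every bond of (2.46) weighs 1) — puts on it the cover
𝒟_j ∪ 𝒟_{j+1} (centres on the M-lattice of each level, each cube's □, □̃, h̃_□ read in ITS level's frame at sites of BOTH
levels: "rescale them to proper scales"), FIXES THE MATCHING CONVENTION h_□ := h̃_□·(Σ_{□′} h̃_{□′}²)^{−1∕2}, and PROVES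
every cover ∕ cube ∕ collar ∕ zone ∕ metric binder of the certificate there, with constants uniform in the box sizes and
in M: n₀ = 2^d + 2^d, s = (1 + 2^{d+2})·(3π∕2)·L, m_g = 1∕(3L), M_c = M∕L, κ = 1∕(2L) (for 2wL ≤ M),
K(a) = e^{ad∕2}·c₀(1, a∕2)^{2d} (L-INDEPENDENT, by the two-scale count of Lemma 2.1′).  The edge theorem
`prop23_assembled_twoLevelBox` is the certificate on this model with ONLY the analytic ∕ fine-lattice ∕ Q′-side binders
and the size conditions left — hypothesis H-B6.5 of the census discharged on two levels, O-9 closed on the model.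

WHAT THIS MODULE PROVES (kernel-checked; no `sorry`, no axiom beyond Lean's three):
1. §1 product profiles on a real frame p ∈ ℝ^d (`bump` = Π_μ h((p_μ − k_μM)∕M), `InCubeR`, `InBigR`): values in [0, 1],
   support in the ⅔M-box (`abs_sub_ctr_lt_of_bump_ne_zero`) ⊂ □ (`inCubeR_of_bump_ne_zero`), the window bound
   Σ_{n=0}^N h(t − n)² ≤ 1 for EVERY real t (`sum_prof_sq_le_one`) hence Σ_k h_k(p)² ≤ 1 always and = 1 for
   0 ≤ p_μ ≤ nM (`sum_bump_sq_le_one`, `sum_bump_sq_eq_one`), finite overlap ≤ 2^d (`card_filter_bump_ne_zero_le`),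
   the Lipschitz bound |h_k(p) − h_k(q)| ≤ (3π∕2)∕M·‖p − q‖₁ (`abs_bump_sub_le`), the support gap and the collar in a
   coordinate (`exists_gt_of_not_inCubeR`, `exists_gt_of_not_inBigR`).
2. §2 the carrier `TL` (fine box ⊕ coarse box), positions `pos` in Λ_j-units (injective, `pos_injective`), the bond
   relation `bond` ∕ graph `graph` (Λ_j-bonds, Λ_{j+1}-bonds, interface bonds), ONE BOND MOVES ONE COORDINATE BY 1 OR
   BY L (`pos_step`), both boxes are box charts (`chart_inl`, `chart_inr`, via `…B6BoxCharts`), the graph is connected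
   (`graph_connected`: "the infimum is attained"), the distance `tdist` = graph distance is a pseudo-distance with
   (2.54) (`isPseudoDist_tdist`, `tdist_triangle`), the POTENTIAL LEMMA (`abs_sub_le_mul_tdist`: per-bond variation c ⟹
   variation ≤ c·d), the fine frame `ff` and the coarse frame `cf` (`ff_inl`, `cf_inr`: a site's own-level frame is its
   index) and their per-bond ℓ¹-variation ≤ L, ≤ 1 (`sum_abs_ff_sub_le_of_adj`, `sum_abs_cf_sub_le_of_adj`), hence
   coordinatewise L-Lipschitz in d (`abs_ff_sub_le`, `abs_cf_sub_le`).
3. §3 the lattice sum (2.61) on the model with an L-INDEPENDENT profile: the two-scale potential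
   ψ_L(t) = |t|∕L + (1 − 1∕L)|t − L·round(t∕L)| (`psi`; 1-Lipschitz `abs_psi_sub_psi_le`, L-periodic part
   `abs_psi_add_sub_psi_le`, dominating the two-scale code `code_le_psi`: |round(t∕L)| + |t − L·round(t∕L)| ≤ 2ψ + 1 for
   L ≥ 2), Ψ_s(y) = Σ_μ ψ_L(x_μ(y) − x_μ(s)) ≤ d(s, y) (`Psi_le_tdist`), the injective code 𝔅 → ℤ^{2d} with
   ‖code‖₁ ≤ 2d(s, y) + d (`l1_code_le`, `code_injective`), and Σ_y e^{−a·d(s,y)} ≤ K(a) := e^{ad∕2}c₀(1, a∕2)^{2d}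
   (`sum_exp_neg_tdist_le`, by `…B6Lemma21TwoScale.sum_exp_le_c0_pow`).
4. §4 the cover: indices `Idx` = fine centres ⊕ coarse centres, h̃_□ = `pre`, □ = `InCube` ∕ `cubeInd`, □̃ = `InBig`,
   S = `sqS`, h_□ = `hfun` = h̃_□∕√S, N_□ = `zone`; 1 ≤ S ≤ 2 (`one_le_sqS`: a site's own-level family is complete at it;
   `sqS_le_two`), S = 2 AT THE INTERFACE CORNER for LM ≥ 3 (`sqS_corner_eq_two` — the obstruction O-9 in the kernel),
   (2.36) Σ_□ h_□² = 1 at every site of both levels (`sum_hfun_sq`), □·h_□ = h_□ (`cubeInd_mul_hfun`), overlap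
   ≤ 2^d + 2^d (`card_filter_hfun_ne_zero_le`), per-bond variation of h_□ ≤ (1 + 2^{d+2})(3π∕2)L∕M
   (`abs_hfun_sub_le_of_adj`, with `abs_inv_sqrt_sub_le`) hence the Lipschitz binder (`abs_hfun_sub_le`), the gap
   d ≥ M∕(3L) (`gap_of_cubeInd_eq_zero`), the collar d(□, □̃ᶜ) ≥ M∕L (`collar`), non-empty zones (`zone_nonempty`).
5. §5 the geometry `tlGeo` (scales j on the fine box, j + 1 on the coarse box) and its metric binders: hρ
   (`tlGeo_isPseudoDist`), (2.54) (`tlGeo_triangle`), hsep with max{|j − j′| − 1, 0} = 0 (`tlGeo_levelSep`), (2.60)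
   (`tlGeo_ineq260`), the profile (`tlGeo_profile`), (2.61)′ and (2.63)′ with constant K(αδ₀) (`tlGeo_ineq261With`,
   `tlGeo_ineq263With` via `…B6Lemma21Repaired.ineq263With_of_261With`).
6. §6 `prop23_assembled_twoLevelBox`: `…B6Prop23CubeDepth.prop23_assembled_fine_twoLevel_cubes` on `tlGeo` with the 26
   cover ∕ cube ∕ collar ∕ zone ∕ metric binders hρ hsep hM h260 hK hPr h261σ h261 h263 hc hs hmg hover hpf01 hph h236
   hLip hcube hgap hN hκ hpfsq hhsq hcollar hzone hdepth DISCHARGED (hdepth by `…B6Prop23CubeDepth.depth_interface`).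
7. §7 `coverTwoLevel_nonvacuous`: the model's side conditions hold together (d = 1, M = 4, n_f = n_c = 5, L = 2, w = 1),
   with non-empty zones, (2.36) for {h_□} at every site, and S = 2 at the corner on the same instance.

TYPING ∕ DIVERGENCE (D-b06.38).  (i) The interface matching of (2.36) is NOT printed: [B6] asserts (2.36) for the union
𝒟 = ⋃_j 𝒟_j of the rescaled (1.118)-families without a prescription near ∂Λ_{j+1}; the model's h_□ = h̃_□·S^{−1∕2} is ONE
explicit convention making the printed assertion true (any other with (2.36), bounded overlap, O(M^{−1})-Lipschitz
constants and supports in □ would serve the certificate equally) — recorded as the model's choice, not as the paper's.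
(ii) h_□ is Lipschitz with |h_□(y) − h_□(y″)| ≤ s∕M·d(y, y″), which is exactly what the first-order expansion behind
(2.83)∕(2.85) ("gives a factor O(M^{−1})") consumes in the tree; C^∞-smoothness is not modelled.  (iii) The carrier is
two adjacent levels, each a box with free boundary (no torus), the coarse box attached along one face; d is the number
of bonds of a shortest admissible contour, every Λ_j-, Λ_{j+1}- and interface bond weighing 1 as in (2.46); the
interface bonds join the fine face {x₀ = 0} to the coarse face one Λ_j-unit below it.  (iv) j_□ := j for EVERY cube
(also the 𝒟_{j+1}-cubes, whose □ contains Λ_j-sites), so the (2.81)-type input h281 is required at the fine scale L^jη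
for all cubes — a weaker use of the hypothesis than level-by-level bookkeeping would allow, honest for the certificate.
(v) L ∈ ℕ, L ≥ 2 (the coarse spacing in fine units); M = m ∈ ℕ, m ≥ 1; n_f, n_c ≥ 5 (so that every □̃ misses a site);
the zone width w satisfies 2wL ≤ M (the collar across the interface is only M∕L deep in d, (2.46) weighing a
Λ_{j+1}-bond of Λ_j-length L by 1).  (vi) The Lipschitz constant s and the gap ∕ collar ∕ depth constants carry the
factors L, 1∕L of the two frames; they are uniform in n_f, n_c, M and enter only «M large enough» (hKM), as printed.

HONEST SCOPE.  Kernel bookkeeping of ONE technical device of [B6] at fixed lattice spacing on a finite two-level model: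
it certifies that the cover ∕ partition-of-unity ∕ enlarged-cube inputs of the Proposition 2.3 chain can be realised
across an interface of two adjacent scales with M-uniform constants, and it exhibits the interface obstruction that the
printed sentence leaves implicit.  It is NOT the k-level statement on T_η, NOT a continuum or ultraviolet-stability
statement, and NOT progress on any Clay problem; the analytic inputs (G′, G′(□̃), Q′, (2.76)∕(2.81), the located size
conditions) remain hypotheses of the edge theorem exactly as upstream.
-/

namespace Literature.MathematicalPhysics.QuantumFieldTheory.Balaban1983to89.B6CoverTwoLevel

open Finset Real
open Literature.Probability.LatticeModels (zdGraph zdGraph_adj_iff)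
open B4Sect5Torus (IsPseudoDist)
open B6DomainChange (Profile)
open B6RandomWalk (HasMajorant Ineq260 Triangle254)
open B6RandomWalkHom (HasMajorantHom)
open B6DomainMajorant (Ctot)
open B6Expansion282 (kerOp locOp Cglued R282)
open B6Prop23Chain (mat)
open B6Lemma21Repaired (Ineq261With Ineq263With)
open B6Ineq268 (LevelSep mx)
open B6Prop23TwoLevel (K285TL)
open B6Prop23CubeDepth (prop23_assembled_fine_twoLevel_cubes depth_interface)
open B6CoverBox (prof ctr prof_nonneg prof_le_one abs_lt_of_prof_ne_zero abs_prof_sub_le prof_of_le_abs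
  prof_of_abs_le sum_prof_sq_eq_one abs_prod_sub_prod_le)
open B6Lemma21TwoScale (l1 sum_exp_le_c0_pow)
open B6BoxCharts (IsBoxChart reachable_of_chart cboxClosed_Icc)

/-! ## §1  Product profiles on a real coordinate frame (the printed h_z of [B5] (1.118) at arbitrary real arguments) -/

section Frame

variable {d C : ℕ}

/-- The product profile Π_μ h((p_μ − k_μM)∕M) of [B5] (1.118) evaluated at an arbitrary real coordinate vector p (the
position of a site of EITHER level written in the frame of the cube's level; on the cube's own level p is integral and
this is `B6CoverBox.hprof`). [cite: Balaban1984PropagatorsI, (1.118) p.36] -/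
noncomputable def bump (m : ℕ) (k : Fin d → Fin C) (p : Fin d → ℝ) : ℝ := ∏ μ, prof ((p μ - ctr m k μ) / m)

/-- p ∈ □_k in the frame of the cube's level: |p_μ − k_μM| ≤ M for every μ (the cube *"of the size 2M"*).
[cite: Balaban1984PropagatorsII, p.229 before (2.36)] -/
def InCubeR (m : ℕ) (k : Fin d → Fin C) (p : Fin d → ℝ) : Prop := ∀ μ, |p μ - ctr m k μ| ≤ m

/-- p ∈ □̃_k, the *"second cube □̃ containing □ in the middle and of the size 4M"*: |p_μ − k_μM| ≤ 2M for every μ.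
[cite: Balaban1984PropagatorsII, p.235 before (2.70)] -/
def InBigR (m : ℕ) (k : Fin d → Fin C) (p : Fin d → ℝ) : Prop := ∀ μ, |p μ - ctr m k μ| ≤ 2 * m

/-- 0 ≤ Π_μ h. [folklore] -/
theorem bump_nonneg (m : ℕ) (k : Fin d → Fin C) (p : Fin d → ℝ) : 0 ≤ bump m k p :=
  Finset.prod_nonneg fun _ _ => prof_nonneg _

/-- Π_μ h ≤ 1. [folklore] -/
theorem bump_le_one (m : ℕ) (k : Fin d → Fin C) (p : Fin d → ℝ) : bump m k p ≤ 1 :=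
  Finset.prod_le_one (fun _ _ => prof_nonneg _) fun _ _ => prof_le_one _

/-- supp h_k lies in the (4M∕3)-cube: h_k(p) ≠ 0 ⟹ |p_μ − k_μM| < ⅔M ([B5] (1.118): supp h ⊂ ]−⅔, ⅔[).
[cite: Balaban1984PropagatorsI, (1.118) p.36] -/
theorem abs_sub_ctr_lt_of_bump_ne_zero {m : ℕ} (hm : 0 < m) {k : Fin d → Fin C} {p : Fin d → ℝ}
    (h : bump m k p ≠ 0) (μ : Fin d) : |p μ - ctr m k μ| < 2 / 3 * m := by
  have hm' : (0 : ℝ) < m := by exact_mod_cast hm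
  have hfac : prof ((p μ - ctr m k μ) / m) ≠ 0 :=
    fun h0 => h (Finset.prod_eq_zero (Finset.mem_univ μ) h0)
  have := abs_lt_of_prof_ne_zero hfac
  rw [abs_div, abs_of_pos hm', div_lt_iff₀ hm'] at this
  linarith

/-- supp h_k ⊂ □_k. [cite: Balaban1984PropagatorsII, p.229 (2.36)] -/
theorem inCubeR_of_bump_ne_zero {m : ℕ} (hm : 0 < m) {k : Fin d → Fin C} {p : Fin d → ℝ}
    (h : bump m k p ≠ 0) : InCubeR m k p := by
  intro μ
  have := abs_sub_ctr_lt_of_bump_ne_zero hm h μ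
  have hm' : (0 : ℝ) ≤ m := Nat.cast_nonneg m
  linarith

/-- The window identity with an argument OUTSIDE the window: Σ_{n=0}^{N} h(t − n)² ≤ 1 for every real t (for t < 0 only
the term n = 0 survives, for t > N only n = N, inside it is `sum_prof_sq_eq_one`). [cite: Balaban1984PropagatorsI, (1.118) p.36] -/
theorem sum_prof_sq_le_one (N : ℕ) (t : ℝ) : ∑ k ∈ Finset.range (N + 1), prof (t - k) ^ 2 ≤ 1 := by
  have hsq : ∀ s : ℝ, prof s ^ 2 ≤ 1 := fun s => pow_le_one₀ (prof_nonneg _) (prof_le_one _)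
  by_cases h0 : 0 ≤ t
  · by_cases h1 : t ≤ N
    · exact (sum_prof_sq_eq_one N t h0 h1).le
    · rw [not_le] at h1
      rw [Finset.sum_range_succ]
      have hz : ∀ k ∈ Finset.range N, prof (t - k) ^ 2 = 0 := by
        intro k hk
        rw [Finset.mem_range] at hk
        have hk' : (k : ℝ) + 1 ≤ N := by exact_mod_cast Nat.succ_le_of_lt hk
        have : 2 / 3 ≤ |t - k| := by
          rw [abs_of_nonneg (by linarith)]
          linarith
        rw [prof_of_le_abs this, zero_pow two_ne_zero]
      rw [Finset.sum_eq_zero hz, zero_add]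
      exact hsq _
  · rw [not_le] at h0
    rw [Finset.sum_range_succ']
    have hz : ∀ k ∈ Finset.range N, prof (t - ((k + 1 : ℕ) : ℝ)) ^ 2 = 0 := by
      intro k _
      have hk : (0 : ℝ) ≤ k := Nat.cast_nonneg k
      have : 2 / 3 ≤ |t - ((k + 1 : ℕ) : ℝ)| := by
        rw [abs_of_nonpos (by push_cast; linarith)]
        push_cast
        linarith
      rw [prof_of_le_abs this, zero_pow two_ne_zero]
    rw [Finset.sum_eq_zero hz, zero_add]
    simp only [Nat.cast_zero, sub_zero]
    exact hsq _

/-- The one-dimensional window sums of the frame p: Σ_{j=0}^{n} h((p_μ − jM)∕M)² as a range sum. [folklore] -/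
theorem sum_fin_prof_sq_eq {n m : ℕ} (hm : 0 < m) (s : ℝ) :
    ∑ j : Fin (n + 1), prof ((s - ((j : ℕ) : ℝ) * m) / m) ^ 2 = ∑ j ∈ Finset.range (n + 1), prof (s / m - j) ^ 2 := by
  have hm' : (0 : ℝ) < m := by exact_mod_cast hm
  calc ∑ j : Fin (n + 1), prof ((s - ((j : ℕ) : ℝ) * m) / m) ^ 2
      = ∑ j ∈ Finset.range (n + 1), prof ((s - (j : ℝ) * m) / m) ^ 2 :=
        Fin.sum_univ_eq_sum_range (fun j : ℕ => prof ((s - (j : ℝ) * m) / m) ^ 2) (n + 1)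
    _ = ∑ j ∈ Finset.range (n + 1), prof (s / m - j) ^ 2 := by
        refine Finset.sum_congr rfl fun j _ => ?_
        rw [sub_div, mul_div_cancel_right₀ _ hm'.ne']

/-- The square sum over the centres factorises over the coordinates: Σ_k h_k(p)² = Π_μ Σ_j h((p_μ − jM)∕M)².
[cite: Balaban1984PropagatorsI, (1.118) p.36] -/
theorem sum_bump_sq_eq_prod {n : ℕ} (m : ℕ) (p : Fin d → ℝ) :
    ∑ k : Fin d → Fin (n + 1), bump m k p ^ 2 = ∏ μ : Fin d, ∑ j : Fin (n + 1), prof ((p μ - ((j : ℕ) : ℝ) * m) / m) ^ 2 := by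
  classical
  calc ∑ k : Fin d → Fin (n + 1), bump m k p ^ 2
      = ∑ k ∈ Fintype.piFinset (fun _ : Fin d => (Finset.univ : Finset (Fin (n + 1)))),
          ∏ μ, prof ((p μ - ((k μ : ℕ) : ℝ) * m) / m) ^ 2 := by
        rw [Fintype.piFinset_univ]
        refine Finset.sum_congr rfl fun k _ => ?_
        simp only [bump, ctr, ← Finset.prod_pow]
    _ = ∏ μ : Fin d, ∑ j : Fin (n + 1), prof ((p μ - ((j : ℕ) : ℝ) * m) / m) ^ 2 :=
        (Finset.prod_univ_sum (fun _ : Fin d => (Finset.univ : Finset (Fin (n + 1))))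
          (fun μ (j : Fin (n + 1)) => prof ((p μ - ((j : ℕ) : ℝ) * m) / m) ^ 2)).symm

/-- **(1.118) on the frame**: Σ_k h_k(p)² = 1 whenever 0 ≤ p_μ ≤ nM for every μ (every window sum is 1).
[cite: Balaban1984PropagatorsI, (1.118) p.36] -/
theorem sum_bump_sq_eq_one {n m : ℕ} (hm : 0 < m) {p : Fin d → ℝ} (h0 : ∀ μ, 0 ≤ p μ) (h1 : ∀ μ, p μ ≤ n * m) :
    ∑ k : Fin d → Fin (n + 1), bump m k p ^ 2 = 1 := by
  have hm' : (0 : ℝ) < m := by exact_mod_cast hm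
  rw [sum_bump_sq_eq_prod]
  refine Finset.prod_eq_one fun μ _ => ?_
  rw [sum_fin_prof_sq_eq hm]
  exact sum_prof_sq_eq_one n (p μ / m) (div_nonneg (h0 μ) hm'.le) (by rw [div_le_iff₀ hm']; exact h1 μ)

/-- … and Σ_k h_k(p)² ≤ 1 for EVERY real frame p (each window sum is ≤ 1). [cite: Balaban1984PropagatorsI, (1.118) p.36] -/
theorem sum_bump_sq_le_one {n m : ℕ} (hm : 0 < m) (p : Fin d → ℝ) :
    ∑ k : Fin d → Fin (n + 1), bump m k p ^ 2 ≤ 1 := by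
  rw [sum_bump_sq_eq_prod]
  refine Finset.prod_le_one (fun μ _ => Finset.sum_nonneg fun j _ => sq_nonneg _) fun μ _ => ?_
  rw [sum_fin_prof_sq_eq hm]
  exact sum_prof_sq_le_one n (p μ / m)

/-- **Finite overlap on the frame**: at most 2^d of the h_k are non-zero at p (in each coordinate the admissible centres
are two consecutive integers). [cite: Balaban1984PropagatorsII, p.229 before (2.36)] -/
theorem card_filter_bump_ne_zero_le {n m : ℕ} (hm : 0 < m) (p : Fin d → ℝ) :
    (Finset.univ.filter fun k : Fin d → Fin (n + 1) => bump m k p ≠ 0).card ≤ 2 ^ d := by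
  classical
  have hm' : (0 : ℝ) < m := by exact_mod_cast hm
  set T : Fin d → Finset (Fin (n + 1)) := fun μ =>
    Finset.univ.filter fun j : Fin (n + 1) => |p μ - ((j : ℕ) : ℝ) * m| < 2 / 3 * m with hT
  have hsub : (Finset.univ.filter fun k : Fin d → Fin (n + 1) => bump m k p ≠ 0) ⊆ Fintype.piFinset T := by
    intro k hk
    rw [Finset.mem_filter] at hk
    rw [Fintype.mem_piFinset]
    intro μ
    simp only [hT, Finset.mem_filter, Finset.mem_univ, true_and]
    exact abs_sub_ctr_lt_of_bump_ne_zero hm hk.2 μ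
  have hTcard : ∀ μ, (T μ).card ≤ 2 := by
    intro μ
    rcases (T μ).eq_empty_or_nonempty with h0 | hne
    · rw [h0, Finset.card_empty]
      exact Nat.zero_le _
    · have haT : (T μ).min' hne ∈ T μ := Finset.min'_mem _ _
      have ha' := (Finset.mem_filter.mp haT).2
      have hbound : ∀ j ∈ T μ, (j : ℕ) = ((T μ).min' hne : ℕ) ∨ (j : ℕ) = ((T μ).min' hne : ℕ) + 1 := by
        intro j hj
        have h1 : (((T μ).min' hne : ℕ)) ≤ (j : ℕ) := Finset.min'_le _ _ hj
        have hj' := (Finset.mem_filter.mp hj).2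
        have e1 := abs_sub_lt_iff.mp hj'
        have e2 := abs_sub_lt_iff.mp ha'
        have h2 : (((j : ℕ) : ℝ) - (((T μ).min' hne : ℕ) : ℝ)) * m < 4 / 3 * m := by
          linarith [e1.1, e1.2, e2.1, e2.2]
        have h3 : ((j : ℕ) : ℝ) - (((T μ).min' hne : ℕ) : ℝ) < 4 / 3 := lt_of_mul_lt_mul_right h2 hm'.le
        have h4 : (j : ℕ) < ((T μ).min' hne : ℕ) + 2 := by
          have : ((j : ℕ) : ℝ) < (((T μ).min' hne : ℕ) : ℝ) + 2 := by linarith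
          exact_mod_cast this
        omega
      calc (T μ).card ≤ ({((T μ).min' hne : ℕ), ((T μ).min' hne : ℕ) + 1} : Finset ℕ).card :=
          Finset.card_le_card_of_injOn (fun j : Fin (n + 1) => (j : ℕ))
            (fun j hj => by
              rcases hbound j (Finset.mem_coe.mp hj) with h | h
              · simp [h]
              · simp [h])
            (fun j _ j' _ h => Fin.ext h)
        _ ≤ 2 := Finset.card_le_two
  calc (Finset.univ.filter fun k : Fin d → Fin (n + 1) => bump m k p ≠ 0).card
      ≤ (Fintype.piFinset T).card := Finset.card_le_card hsub
    _ = ∏ μ, (T μ).card := Fintype.card_piFinset T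
    _ ≤ 2 ^ (Finset.univ : Finset (Fin d)).card := Finset.prod_le_pow_card _ _ _ fun μ _ => hTcard μ
    _ = 2 ^ d := by rw [Finset.card_univ, Fintype.card_fin]

/-- **The Lipschitz bound on the frame**: |h_k(p) − h_k(q)| ≤ (3π∕2)∕M · Σ_μ |p_μ − q_μ|.
[cite: Balaban1984PropagatorsII, p.238 before (2.85) «gives a factor O(M⁻¹)»; (2.85)] -/
theorem abs_bump_sub_le {m : ℕ} (hm : 0 < m) (k : Fin d → Fin C) (p q : Fin d → ℝ) :
    |bump m k p - bump m k q| ≤ 3 * π / 2 / m * ∑ μ, |p μ - q μ| := by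
  have hm' : (0 : ℝ) < m := by exact_mod_cast hm
  unfold bump
  calc |∏ μ, prof ((p μ - ctr m k μ) / m) - ∏ μ, prof ((q μ - ctr m k μ) / m)|
      ≤ ∑ μ, |prof ((p μ - ctr m k μ) / m) - prof ((q μ - ctr m k μ) / m)| :=
        abs_prod_sub_prod_le _ (fun μ => ⟨prof_nonneg _, prof_le_one _⟩)
          (fun μ => ⟨prof_nonneg _, prof_le_one _⟩)
    _ ≤ ∑ μ, 3 * π / 2 / m * |p μ - q μ| := by
        refine Finset.sum_le_sum fun μ _ => ?_
        calc |prof ((p μ - ctr m k μ) / m) - prof ((q μ - ctr m k μ) / m)|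
            ≤ 3 * π / 2 * |(p μ - ctr m k μ) / m - (q μ - ctr m k μ) / m| := abs_prof_sub_le _ _
          _ = 3 * π / 2 / m * |p μ - q μ| := by
              rw [← sub_div, abs_div, abs_of_pos hm', sub_sub_sub_cancel_right]
              ring
    _ = 3 * π / 2 / m * ∑ μ, |p μ - q μ| := by rw [Finset.mul_sum]

/-- **The support gap on the frame**: p ∉ □_k and h_k(q) ≠ 0 ⟹ in some coordinate |p_μ − q_μ| > M∕3.
[cite: Balaban1984PropagatorsII, p.229 (2.36); p.237 (2.83)] -/
theorem exists_gt_of_not_inCubeR {m : ℕ} (hm : 0 < m) {k : Fin d → Fin C} {p q : Fin d → ℝ}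
    (hp : ¬ InCubeR m k p) (hq : bump m k q ≠ 0) : ∃ μ, 1 / 3 * (m : ℝ) < |p μ - q μ| := by
  obtain ⟨μ, hμ⟩ := not_forall.mp hp
  refine ⟨μ, ?_⟩
  have h1 : (m : ℝ) < |p μ - ctr m k μ| := not_le.mp hμ
  have h2 := abs_sub_ctr_lt_of_bump_ne_zero hm hq μ
  have h3 : |p μ - ctr m k μ| - |q μ - ctr m k μ| ≤ |p μ - q μ| := by
    have := abs_sub_abs_le_abs_sub (p μ - ctr m k μ) (q μ - ctr m k μ)
    rwa [sub_sub_sub_cancel_right] at this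
  linarith

/-- **The collar on the frame**: p ∈ □_k and q ∉ □̃_k ⟹ in some coordinate |p_μ − q_μ| > M (*"□̃ containing □ in the
middle and of the size 4M"*, □ of the size 2M). [cite: Balaban1984PropagatorsII, p.235 before (2.70)] -/
theorem exists_gt_of_not_inBigR {m : ℕ} {k : Fin d → Fin C} {p q : Fin d → ℝ} (hp : InCubeR m k p)
    (hq : ¬ InBigR m k q) : ∃ μ, (m : ℝ) < |p μ - q μ| := by
  obtain ⟨μ, hμ⟩ := not_forall.mp hq
  refine ⟨μ, ?_⟩
  have h1 : 2 * (m : ℝ) < |q μ - ctr m k μ| := not_le.mp hμ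
  have h2 := hp μ
  have h3 : |q μ - ctr m k μ| - |p μ - ctr m k μ| ≤ |p μ - q μ| := by
    have := abs_sub_abs_le_abs_sub (q μ - ctr m k μ) (p μ - ctr m k μ)
    rw [sub_sub_sub_cancel_right, abs_sub_comm (q μ) (p μ)] at this
    exact this
  linarith

end Frame

/-! ## §2  The two-level carrier: a box of Λ_j-points glued to a box of Λ_{j+1}-points, its bond graph and (2.46) -/

section Carrier

variable {d a b : ℕ}

/-- The integer coordinate vector of a box index. [folklore] -/
def zv {S : ℕ} (x : Fin d → Fin S) : Fin d → ℤ := fun μ => ((x μ : ℕ) : ℤ)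

/-- A lattice step changes one coordinate by one. [folklore] -/
theorem zv_step {S : ℕ} {x x' : Fin d → Fin S} (h : (zdGraph d).Adj (zv x) (zv x')) :
    ∃ μ, (∀ ν, ν ≠ μ → zv x ν = zv x' ν) ∧ |zv x μ - zv x' μ| = 1 := by
  obtain ⟨μ, hμ | hμ⟩ := (zdGraph_adj_iff _ _).1 h
  · refine ⟨μ, fun ν hν => ?_, ?_⟩
    · have := congr_fun hμ ν
      rw [Pi.add_apply, Pi.single_eq_of_ne hν, add_zero] at this
      exact this.symm
    · have := congr_fun hμ μ
      rw [Pi.add_apply, Pi.single_eq_same] at this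
      rw [this]; simp
  · refine ⟨μ, fun ν hν => ?_, ?_⟩
    · have := congr_fun hμ ν
      rw [Pi.add_apply, Pi.single_eq_of_ne hν, add_zero] at this
      exact this
    · have := congr_fun hμ μ
      rw [Pi.add_apply, Pi.single_eq_same] at this
      rw [this]; simp

/-- Clamping ℤ^d into the box {0, …, N}^d (a chart map). [folklore] -/
def clampBox (N : ℕ) (z : Fin d → ℤ) : Fin d → Fin (N + 1) := fun μ => ⟨min (z μ).toNat N, by omega⟩

/-- Clamping a vector of the box returns it (left inverse on the box). [folklore] -/
theorem zv_clampBox {N : ℕ} {z : Fin d → ℤ} (hz : z ∈ Set.Icc (0 : Fin d → ℤ) (fun _ => (N : ℤ))) :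
    zv (clampBox N z) = z := by
  funext μ
  have h0 : 0 ≤ z μ := hz.1 μ
  have h1 : z μ ≤ N := hz.2 μ
  simp only [zv, clampBox]
  omega

/-- Clamping the integer image of a box index returns the index. [folklore] -/
theorem clampBox_zv {N : ℕ} (x : Fin d → Fin (N + 1)) : clampBox N (zv x) = x := by
  funext μ
  apply Fin.ext
  simp only [clampBox, zv, Int.toNat_natCast]
  exact Nat.min_eq_left (Nat.lt_succ_iff.mp (x μ).isLt)

/-- The integer image of a box index lies in the box. [folklore] -/
theorem zv_mem_Icc {N : ℕ} (x : Fin d → Fin (N + 1)) : zv x ∈ Set.Icc (0 : Fin d → ℤ) (fun _ => (N : ℤ)) := by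
  refine ⟨fun μ => Int.natCast_nonneg _, fun μ => ?_⟩
  simp only [zv]
  exact_mod_cast Nat.lt_succ_iff.mp (x μ).isLt

variable [NeZero d]

/-- The sites: the Λ_j-points of a fine box (index `Sum.inl x`, x ∈ {0, …, a}^d, unit lattice) and the Λ_{j+1}-points of a
coarse box (index `Sum.inr i`, i ∈ {0, …, b}^d, lattice of spacing L in Λ_j-units) — 𝔅 = (Λ_j ∩ B^j(Λ_j)) ∪
(Λ_{j+1} ∩ B^{j+1}(Λ_{j+1})) for two adjacent levels. [cite: Balaban1984PropagatorsII, (2.1)–(2.4) p.224] -/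
abbrev TL (d a b : ℕ) : Type := (Fin d → Fin (a + 1)) ⊕ (Fin d → Fin (b + 1))

/-- The POSITION of a site in Λ_j-units (integer coordinates): the fine point x sits at x, the coarse point i at
(−1 − L·i₀, L·i₁, …, L·i_{d−1}) — the coarse box lies below the hyperplane {x₀ = −1}, its face one Λ_j-bond away from
the face {x₀ = 0} of the fine box, its points on the lattice LΛ_j = Λ_{j+1}. [cite: Balaban1984PropagatorsII, (2.1)–(2.3) p.224] -/
def pos (L : ℕ) : TL d a b → (Fin d → ℤ)
  | Sum.inl x => zv x
  | Sum.inr i => fun μ => if μ = 0 then -1 - (L : ℤ) * ((i 0 : ℕ) : ℤ) else (L : ℤ) * ((i μ : ℕ) : ℤ)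

/-- The BONDS: the Λ_j-bonds of the fine box (nearest neighbours of ℤ^d), the Λ_{j+1}-bonds of the coarse box (nearest
neighbours of the index lattice, i.e. points at Λ_j-distance L), and the INTERFACE Λ_j-bonds joining the face point
(0, Lv) of the fine box to the face point (−1, Lv) = coarse index (0, v) of the coarse box — (2.46): *"a part of Γ_{y,y′}
contained in B^j(Λ_j) consists of bonds of the lattice Λ_j"*. [cite: Balaban1984PropagatorsII, (2.46) p.231] -/
def bond (L : ℕ) : TL d a b → TL d a b → Prop
  | Sum.inl x, Sum.inl x' => (zdGraph d).Adj (zv x) (zv x')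
  | Sum.inr i, Sum.inr i' => (zdGraph d).Adj (zv i) (zv i')
  | Sum.inl x, Sum.inr i => x 0 = 0 ∧ i 0 = 0 ∧ ∀ μ, μ ≠ 0 → ((x μ : ℕ) : ℤ) = (L : ℤ) * ((i μ : ℕ) : ℤ)
  | Sum.inr _, Sum.inl _ => False

/-- The two-level bond graph. [cite: Balaban1984PropagatorsII, (2.46) p.231] -/
def graph (L : ℕ) : SimpleGraph (TL d a b) := SimpleGraph.fromRel (bond L)

/-- Position of a fine site = its index vector. [folklore] -/
theorem pos_inl (L : ℕ) (x : Fin d → Fin (a + 1)) : pos L (Sum.inl x : TL d a b) = zv x := rfl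

/-- 0-th position of a coarse site: one Λ_j-unit below the fine face, then spacing L. [folklore] -/
theorem pos_inr_zero (L : ℕ) (i : Fin d → Fin (b + 1)) :
    pos L (Sum.inr i : TL d a b) 0 = -1 - (L : ℤ) * ((i 0 : ℕ) : ℤ) := by
  simp [pos]

/-- Tangential positions of a coarse site: spacing L. [folklore] -/
theorem pos_inr_of_ne (L : ℕ) (i : Fin d → Fin (b + 1)) {μ : Fin d} (hμ : μ ≠ 0) :
    pos L (Sum.inr i : TL d a b) μ = (L : ℤ) * ((i μ : ℕ) : ℤ) := by
  simp [pos, hμ]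

/-- **One bond moves one coordinate of the position, by 1 (a Λ_j-bond or an interface bond) or by L (a Λ_{j+1}-bond).**
[cite: Balaban1984PropagatorsII, (2.46) p.231] -/
theorem pos_step_of_bond (L : ℕ) {y y' : TL d a b} (h : bond L y y') :
    ∃ μ, (∀ ν, ν ≠ μ → pos L y ν = pos L y' ν) ∧ (|pos L y μ - pos L y' μ| = 1 ∨ |pos L y μ - pos L y' μ| = L) := by
  match y, y', h with
  | Sum.inl x, Sum.inl x', h =>
    obtain ⟨μ, h1, h2⟩ := zv_step h
    exact ⟨μ, h1, Or.inl h2⟩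
  | Sum.inr i, Sum.inr i', h =>
    obtain ⟨μ, h1, h2⟩ := zv_step h
    refine ⟨μ, fun ν hν => ?_, Or.inr ?_⟩
    · by_cases hν0 : ν = 0
      · subst hν0
        rw [pos_inr_zero, pos_inr_zero]
        have := h1 0 hν
        simp only [zv] at this
        rw [this]
      · rw [pos_inr_of_ne L i hν0, pos_inr_of_ne L i' hν0]
        have := h1 ν hν
        simp only [zv] at this
        rw [this]
    · by_cases hμ0 : μ = 0
      · subst hμ0
        rw [pos_inr_zero, pos_inr_zero]
        simp only [zv] at h2
        rw [show -1 - (L : ℤ) * ((i 0 : ℕ) : ℤ) - (-1 - (L : ℤ) * ((i' 0 : ℕ) : ℤ)) =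
          -((L : ℤ) * (((i 0 : ℕ) : ℤ) - ((i' 0 : ℕ) : ℤ))) by ring, abs_neg, abs_mul, h2]
        simp
      · rw [pos_inr_of_ne L i hμ0, pos_inr_of_ne L i' hμ0, ← mul_sub, abs_mul]
        simp only [zv] at h2
        rw [h2]
        simp
  | Sum.inl x, Sum.inr i, h =>
    obtain ⟨hx, hi, hrest⟩ := h
    refine ⟨0, fun ν hν => ?_, Or.inl ?_⟩
    · rw [pos_inl, pos_inr_of_ne L i hν]
      exact hrest ν hν
    · rw [pos_inl, pos_inr_zero]
      simp [zv, hx, hi]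

/-- The same for an edge of the bond graph (either orientation). [cite: Balaban1984PropagatorsII, (2.46) p.231] -/
theorem pos_step {L : ℕ} {y y' : TL d a b} (h : (graph L).Adj y y') :
    ∃ μ, (∀ ν, ν ≠ μ → pos L y ν = pos L y' ν) ∧ (|pos L y μ - pos L y' μ| = 1 ∨ |pos L y μ - pos L y' μ| = L) := by
  rw [graph, SimpleGraph.fromRel_adj] at h
  rcases h.2 with h' | h'
  · exact pos_step_of_bond L h'
  · obtain ⟨μ, h1, h2⟩ := pos_step_of_bond L h'
    refine ⟨μ, fun ν hν => (h1 ν hν).symm, ?_⟩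
    rwa [abs_sub_comm]

/-- The position determines the site (fine points have x₀ ≥ 0, coarse points x₀ ≤ −1). [folklore] -/
theorem pos_injective {L : ℕ} (hL : 0 < L) : Function.Injective (pos L : TL d a b → (Fin d → ℤ)) := by
  have hL' : (L : ℤ) ≠ 0 := by exact_mod_cast hL.ne'
  intro y y' h
  match y, y', h with
  | Sum.inl x, Sum.inl x', h =>
    congr 1
    funext μ
    have := congr_fun h μ
    simp only [pos, zv, Nat.cast_inj] at this
    exact Fin.ext this
  | Sum.inr i, Sum.inr i', h =>
    congr 1
    funext μ
    have := congr_fun h μ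
    by_cases hμ : μ = 0
    · subst hμ
      simp only [pos, if_true] at this
      have : (L : ℤ) * ((i 0 : ℕ) : ℤ) = (L : ℤ) * ((i' 0 : ℕ) : ℤ) := by linarith
      exact Fin.ext (by exact_mod_cast mul_left_cancel₀ hL' this)
    · simp only [pos, hμ, if_false] at this
      exact Fin.ext (by exact_mod_cast mul_left_cancel₀ hL' this)
  | Sum.inl x, Sum.inr i, h =>
    exfalso
    have := congr_fun h 0
    simp only [pos, zv, if_true] at this
    have h0 : (0 : ℤ) ≤ ((x 0 : ℕ) : ℤ) := Int.natCast_nonneg _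
    have h1 : (0 : ℤ) ≤ (L : ℤ) * ((i 0 : ℕ) : ℤ) := by positivity
    linarith
  | Sum.inr i, Sum.inl x, h =>
    exfalso
    have := congr_fun h 0
    simp only [pos, zv, if_true] at this
    have h0 : (0 : ℤ) ≤ ((x 0 : ℕ) : ℤ) := Int.natCast_nonneg _
    have h1 : (0 : ℤ) ≤ (L : ℤ) * ((i 0 : ℕ) : ℤ) := by positivity
    linarith

/-! ### Connectivity: each box is a chart of the bond graph, and one interface bond links them -/

/-- The fine box is a box chart of the bond graph (all its Λ_j-bonds are bonds). [cite: Balaban1984PropagatorsII, p.231] -/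
theorem chart_inl (L : ℕ) :
    IsBoxChart (graph L : SimpleGraph (TL d a b)) (Set.Icc 0 (fun _ => (a : ℤ))) (fun z => Sum.inl (clampBox a z)) := by
  refine ⟨cboxClosed_Icc _ _, fun z z' hz hz' h => ?_⟩
  rw [graph, SimpleGraph.fromRel_adj]
  refine ⟨fun heq => h.ne ?_, Or.inl ?_⟩
  · have := Sum.inl_injective heq
    rw [← zv_clampBox hz, ← zv_clampBox hz', this]
  · show (zdGraph d).Adj (zv (clampBox a z)) (zv (clampBox a z'))
    rwa [zv_clampBox hz, zv_clampBox hz']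

/-- The coarse box is a box chart of the bond graph (all its Λ_{j+1}-bonds are bonds). [cite: Balaban1984PropagatorsII, p.231] -/
theorem chart_inr (L : ℕ) :
    IsBoxChart (graph L : SimpleGraph (TL d a b)) (Set.Icc 0 (fun _ => (b : ℤ))) (fun z => Sum.inr (clampBox b z)) := by
  refine ⟨cboxClosed_Icc _ _, fun z z' hz hz' h => ?_⟩
  rw [graph, SimpleGraph.fromRel_adj]
  refine ⟨fun heq => h.ne ?_, Or.inl ?_⟩
  · have := Sum.inr_injective heq
    rw [← zv_clampBox hz, ← zv_clampBox hz', this]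
  · show (zdGraph d).Adj (zv (clampBox b z)) (zv (clampBox b z'))
    rwa [zv_clampBox hz, zv_clampBox hz']

/-- The interface bond between the corners. [cite: Balaban1984PropagatorsII, (2.46) p.231] -/
theorem adj_corner (L : ℕ) : (graph L : SimpleGraph (TL d a b)).Adj (Sum.inl 0) (Sum.inr 0) := by
  rw [graph, SimpleGraph.fromRel_adj]
  refine ⟨Sum.inl_ne_inr, Or.inl ?_⟩
  refine ⟨rfl, rfl, fun μ _ => ?_⟩
  simp

/-- **The two-level bond graph is connected** (staircases inside each box + the interface bond), so the infimum (2.46)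
is attained: *"Of course the infimum is attained at some contour Γ_{y,y′}"*. [cite: Balaban1984PropagatorsII, p.231] -/
theorem graph_connected (L : ℕ) : (graph L : SimpleGraph (TL d a b)).Connected := by
  have hf : ∀ x : Fin d → Fin (a + 1), (graph L : SimpleGraph (TL d a b)).Reachable (Sum.inl x) (Sum.inl 0) := by
    intro x
    have := reachable_of_chart (chart_inl (d := d) (a := a) (b := b) L) (zv_mem_Icc x) (zv_mem_Icc 0)
    rwa [clampBox_zv, clampBox_zv] at this
  have hc : ∀ i : Fin d → Fin (b + 1), (graph L : SimpleGraph (TL d a b)).Reachable (Sum.inr 0) (Sum.inr i) := by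
    intro i
    have := reachable_of_chart (chart_inr (d := d) (a := a) (b := b) L) (zv_mem_Icc 0) (zv_mem_Icc i)
    rwa [clampBox_zv, clampBox_zv] at this
  have key : ∀ y : TL d a b, (graph L).Reachable y (Sum.inr 0) := by
    rintro (x | i)
    · exact (hf x).trans (adj_corner L).reachable
    · exact (hc i).symm
  exact (SimpleGraph.connected_iff _).2 ⟨fun y y' => (key y).trans (key y').symm, ⟨Sum.inr 0⟩⟩

/-! ### The distance (2.46) of the model = the graph distance of the bond graph -/

/-- d(y, y′) := the number of bonds of a shortest admissible contour — (2.46) with every Λ_j-bond counting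
(L^jη)^{−1}·L^jη = 1 and every Λ_{j+1}-bond (L^{j+1}η)^{−1}·L^{j+1}η = 1. [cite: Balaban1984PropagatorsII, (2.46) p.231] -/
noncomputable def tdist (L : ℕ) (y y' : TL d a b) : ℝ := ((graph L).dist y y' : ℝ)

/-- d(y, y) = 0. [folklore] -/
theorem tdist_self (L : ℕ) (y : TL d a b) : tdist L y y = 0 := by
  simp [tdist]

/-- d is symmetric. [folklore] -/
theorem tdist_comm (L : ℕ) (y y' : TL d a b) : tdist L y y' = tdist L y' y := by
  unfold tdist
  rw [SimpleGraph.dist_comm]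

/-- d ≥ 0. [folklore] -/
theorem tdist_nonneg (L : ℕ) (y y' : TL d a b) : 0 ≤ tdist L y y' := Nat.cast_nonneg _

/-- (2.54) on the model. [cite: Balaban1984PropagatorsII, (2.54) p.233] -/
theorem tdist_triangle (L : ℕ) (y y' y'' : TL d a b) : tdist L y y'' ≤ tdist L y y' + tdist L y' y'' := by
  unfold tdist
  exact_mod_cast (graph_connected L).dist_triangle

/-- d is a pseudo-distance (the binder `hρ`). [folklore] -/
theorem isPseudoDist_tdist (L : ℕ) : IsPseudoDist (tdist L : TL d a b → TL d a b → ℝ) :=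
  ⟨tdist_comm L, tdist_self L, tdist_triangle L⟩

/-- **Potentials**: a function changing by at most c along every bond changes by at most c·d(y, y′) between any two
sites (sum along a shortest contour). [folklore] -/
theorem abs_sub_le_mul_tdist (L : ℕ) {Φ : TL d a b → ℝ} {c : ℝ}
    (hΦ : ∀ y y', (graph L).Adj y y' → |Φ y - Φ y'| ≤ c) (y y' : TL d a b) : |Φ y - Φ y'| ≤ c * tdist L y y' := by
  obtain ⟨p, hp⟩ := ((graph_connected L).preconnected y y').exists_walk_length_eq_dist
  unfold tdist
  rw [← hp]
  clear hp
  induction p with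
  | nil => simp
  | @cons u v w h p ih =>
    rw [SimpleGraph.Walk.length_cons]
    push_cast
    calc |Φ u - Φ w| ≤ |Φ u - Φ v| + |Φ v - Φ w| := abs_sub_le _ _ _
      _ ≤ c + c * (p.length : ℝ) := add_le_add (hΦ u v h) ih
      _ = c * ((p.length : ℝ) + 1) := by ring

/-- **The fine frame**: the position in Λ_j-units, as a real vector. [cite: Balaban1984PropagatorsII, (2.1)–(2.3) p.224] -/
noncomputable def ff (L : ℕ) (y : TL d a b) (μ : Fin d) : ℝ := ((pos L y μ : ℤ) : ℝ)

/-- **The coarse frame**: the position in Λ_{j+1}-units measured from the face of the coarse box (x₀ ↦ −(x₀ + 1)∕L,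
x_μ ↦ x_μ∕L) — the coarse point with index i has coarse frame i. [cite: Balaban1984PropagatorsII, (2.1)–(2.3) p.224] -/
noncomputable def cf (L : ℕ) (y : TL d a b) (μ : Fin d) : ℝ :=
  if μ = 0 then -(((pos L y 0 : ℤ) : ℝ) + 1) / L else ((pos L y μ : ℤ) : ℝ) / L

/-- The fine frame of a fine site is its index. [folklore] -/
theorem ff_inl (L : ℕ) (x : Fin d → Fin (a + 1)) (μ : Fin d) : ff L (Sum.inl x : TL d a b) μ = ((x μ : ℕ) : ℝ) := by
  simp [ff, pos, zv]

/-- The coarse frame of a coarse site is its index ("rescale them to proper scales", p.229). [folklore] -/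
theorem cf_inr {L : ℕ} (hL : 0 < L) (i : Fin d → Fin (b + 1)) (μ : Fin d) :
    cf L (Sum.inr i : TL d a b) μ = ((i μ : ℕ) : ℝ) := by
  have hL' : (L : ℝ) ≠ 0 := by exact_mod_cast hL.ne'
  by_cases hμ : μ = 0
  · subst hμ
    rw [cf, if_pos rfl, pos_inr_zero]
    push_cast
    field_simp
    ring
  · rw [cf, if_neg hμ, pos_inr_of_ne L i hμ]
    push_cast
    field_simp

/-- The coarse frame moves by |Δx_μ|∕L in each coordinate. [folklore] -/
theorem abs_cf_sub (L : ℕ) (hL : 0 < L) (y y' : TL d a b) (μ : Fin d) :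
    |cf L y μ - cf L y' μ| = |((pos L y μ : ℤ) : ℝ) - pos L y' μ| / L := by
  have hL' : (0 : ℝ) < L := by exact_mod_cast hL
  by_cases hμ : μ = 0
  · subst hμ
    simp only [cf, if_true]
    rw [show -(((pos L y 0 : ℤ) : ℝ) + 1) / L - -(((pos L y' 0 : ℤ) : ℝ) + 1) / L
        = -((((pos L y 0 : ℤ) : ℝ) - pos L y' 0) / L) by ring, abs_neg, abs_div, abs_of_pos hL']
  · simp only [cf, hμ, if_false]
    rw [← sub_div, abs_div, abs_of_pos hL']

/-- Along one bond the fine frame moves by at most L in ℓ¹. [cite: Balaban1984PropagatorsII, (2.46) p.231] -/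
theorem sum_abs_ff_sub_le_of_adj {L : ℕ} (hL : 1 ≤ L) {y y' : TL d a b} (h : (graph L).Adj y y') :
    ∑ μ, |ff L y μ - ff L y' μ| ≤ L := by
  obtain ⟨μ, h1, h2⟩ := pos_step h
  have hL' : (1 : ℝ) ≤ L := by exact_mod_cast hL
  rw [Finset.sum_eq_single μ (fun ν _ hν => by rw [ff, ff, h1 ν hν, sub_self, abs_zero])
    (fun hμ => absurd (Finset.mem_univ μ) hμ)]
  simp only [ff]
  rw [← Int.cast_sub, ← Int.cast_abs]
  rcases h2 with h2 | h2
  · rw [h2]; simpa using hL'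
  · rw [h2]; simp

/-- Along one bond the coarse frame moves by at most 1 in ℓ¹. [cite: Balaban1984PropagatorsII, (2.46) p.231] -/
theorem sum_abs_cf_sub_le_of_adj {L : ℕ} (hL : 1 ≤ L) {y y' : TL d a b} (h : (graph L).Adj y y') :
    ∑ μ, |cf L y μ - cf L y' μ| ≤ 1 := by
  have hL0 : 0 < L := hL
  have hL' : (0 : ℝ) < L := by exact_mod_cast hL0
  have key : ∑ μ, |cf L y μ - cf L y' μ| = (∑ μ, |ff L y μ - ff L y' μ|) / L := by
    rw [Finset.sum_div]
    exact Finset.sum_congr rfl fun μ _ => by rw [abs_cf_sub L hL0]; rfl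
  rw [key, div_le_one hL']
  exact sum_abs_ff_sub_le_of_adj hL h

/-- **The fine frame is L-Lipschitz in d, coordinatewise**: |x_μ(y) − x_μ(y′)| ≤ L·d(y, y′).
[cite: Balaban1984PropagatorsII, (2.46) p.231] -/
theorem abs_ff_sub_le {L : ℕ} (hL : 1 ≤ L) (y y' : TL d a b) (μ : Fin d) :
    |ff L y μ - ff L y' μ| ≤ L * tdist L y y' := by
  refine abs_sub_le_mul_tdist L (Φ := fun z => ff L z μ) (fun z z' h => ?_) y y'
  exact le_trans (Finset.single_le_sum (f := fun ν => |ff L z ν - ff L z' ν|) (fun _ _ => abs_nonneg _)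
    (Finset.mem_univ μ)) (sum_abs_ff_sub_le_of_adj (y := z) (y' := z') hL h)

/-- **The coarse frame is 1-Lipschitz (hence L-Lipschitz) in d, coordinatewise.** [cite: Balaban1984PropagatorsII, (2.46) p.231] -/
theorem abs_cf_sub_le {L : ℕ} (hL : 1 ≤ L) (y y' : TL d a b) (μ : Fin d) :
    |cf L y μ - cf L y' μ| ≤ L * tdist L y y' := by
  have h1 : |cf L y μ - cf L y' μ| ≤ 1 * tdist L y y' := by
    refine abs_sub_le_mul_tdist L (Φ := fun z => cf L z μ) (fun z z' h => ?_) y y'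
    exact le_trans (Finset.single_le_sum (f := fun ν => |cf L z ν - cf L z' ν|) (fun _ _ => abs_nonneg _)
      (Finset.mem_univ μ)) (sum_abs_cf_sub_le_of_adj hL h)
  have hL' : (1 : ℝ) ≤ L := by exact_mod_cast hL
  exact h1.trans (mul_le_mul_of_nonneg_right hL' (tdist_nonneg L y y'))

end Carrier

/-! ## §3  The lattice sum (2.61) on the two-level model: an L-INDEPENDENT profile K via the two-scale count -/

section Count

/-- The TWO-SCALE POTENTIAL of one integer coordinate t (in Λ_j-units, L = the coarse spacing):
ψ_L(t) = |t|∕L + (1 − 1∕L)·|t − L·round(t∕L)| — it costs ≤ 1 per Λ_j-bond (t ↦ t ± 1) AND ≤ 1 per Λ_{j+1}-bond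
(t ↦ t ± L), and it dominates half the ℓ¹-size of the two-scale code (round(t∕L), t − L·round(t∕L)) of t.  This is the
device that makes the count behind (2.61) uniform in L on a carrier mixing both lattices (Lemma 2.1′ of the cell,
`…B6Lemma21TwoScale`). [cite: Balaban1984PropagatorsII, (2.58) p.233 (the count «(c₀(½α))^{d(2m+1)}»)] [folklore] -/
noncomputable def psi (L : ℝ) (t : ℝ) : ℝ := |t| / L + (1 - 1 / L) * |t - L * round (t / L)|

/-- ψ_L(0) = 0. [folklore] -/
theorem psi_zero {L : ℝ} : psi L 0 = 0 := by
  simp [psi]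

/-- ψ_L ≥ 0 for L ≥ 1. [folklore] -/
theorem psi_nonneg {L : ℝ} (hL : 1 ≤ L) (t : ℝ) : 0 ≤ psi L t := by
  have h1 : 0 ≤ 1 - 1 / L := by
    rw [sub_nonneg, div_le_one (by linarith)]
    exact hL
  unfold psi
  positivity

/-- The deviation from LΛ is 1-Lipschitz: |dev(t) − dev(t′)| ≤ |t − t′| (round minimises the distance). [folklore] -/
theorem abs_dev_sub_dev_le {L : ℝ} (hL : 0 < L) (t t' : ℝ) :
    abs (|t - L * round (t / L)| - |t' - L * round (t' / L)|) ≤ |t - t'| := by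
  have key : ∀ u u' : ℝ, |u - L * round (u / L)| ≤ |u' - L * round (u' / L)| + |u - u'| := by
    intro u u'
    have h1 : |u / L - round (u / L)| ≤ |u / L - round (u' / L)| := round_le _ _
    have h2 : |u - L * round (u / L)| = L * |u / L - round (u / L)| := by
      rw [← abs_of_pos hL, ← abs_mul, abs_of_pos hL]
      congr 1
      field_simp
    have h3 : |u - L * round (u' / L)| = L * |u / L - round (u' / L)| := by
      rw [← abs_of_pos hL, ← abs_mul, abs_of_pos hL]
      congr 1
      field_simp
    have h4 : |u - L * round (u' / L)| ≤ |u' - L * round (u' / L)| + |u - u'| := by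
      have := abs_add_le (u' - L * round (u' / L)) (u - u')
      rwa [show u' - L * round (u' / L) + (u - u') = u - L * round (u' / L) by ring] at this
    calc |u - L * round (u / L)| = L * |u / L - round (u / L)| := h2
      _ ≤ L * |u / L - round (u' / L)| := mul_le_mul_of_nonneg_left h1 hL.le
      _ = |u - L * round (u' / L)| := h3.symm
      _ ≤ |u' - L * round (u' / L)| + |u - u'| := h4
  rw [abs_sub_le_iff]
  constructor
  · linarith [key t t']
  · linarith [key t' t, abs_sub_comm t t']

/-- **ψ_L is 1-Lipschitz** (so a Λ_j-bond, moving t by 1, costs ≤ 1). [folklore] -/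
theorem abs_psi_sub_psi_le {L : ℝ} (hL : 1 ≤ L) (t t' : ℝ) : |psi L t - psi L t'| ≤ |t - t'| := by
  have hL0 : 0 < L := by linarith
  have h1 : 0 ≤ 1 - 1 / L := by
    rw [sub_nonneg, div_le_one hL0]
    exact hL
  have e1 : |(|t| / L) - |t'| / L| ≤ |t - t'| / L := by
    rw [← sub_div, abs_div, abs_of_pos hL0]
    exact div_le_div_of_nonneg_right (abs_abs_sub_abs_le_abs_sub t t') hL0.le
  have e2 := abs_dev_sub_dev_le hL0 t t'
  unfold psi
  calc |(|t| / L + (1 - 1 / L) * |t - L * round (t / L)|) - (|t'| / L + (1 - 1 / L) * |t' - L * round (t' / L)|)|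
      = |(|t| / L - |t'| / L) + (1 - 1 / L) * (|t - L * round (t / L)| - |t' - L * round (t' / L)|)| := by ring_nf
    _ ≤ |(|t| / L) - |t'| / L| + |(1 - 1 / L) * (|t - L * round (t / L)| - |t' - L * round (t' / L)|)| := abs_add_le _ _
    _ ≤ |t - t'| / L + (1 - 1 / L) * |t - t'| := by
        rw [abs_mul, abs_of_nonneg h1]
        exact add_le_add e1 (mul_le_mul_of_nonneg_left e2 h1)
    _ = |t - t'| := by field_simp; ring

/-- **A Λ_{j+1}-bond, moving t by L, costs ≤ 1**: |ψ_L(t + L) − ψ_L(t)| ≤ 1 (the deviation is L-periodic).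
[folklore] -/
theorem abs_psi_add_sub_psi_le {L : ℝ} (hL : 1 ≤ L) (t : ℝ) : |psi L (t + L) - psi L t| ≤ 1 := by
  have hL0 : 0 < L := by linarith
  have hper : |t + L - L * round ((t + L) / L)| = |t - L * round (t / L)| := by
    rw [show (t + L) / L = t / L + 1 by field_simp, round_add_one]
    push_cast
    ring_nf
  unfold psi
  rw [hper]
  have e1 : |(|t + L| / L) - |t| / L| ≤ 1 := by
    rw [← sub_div, abs_div, abs_of_pos hL0, div_le_one hL0]
    have := abs_abs_sub_abs_le_abs_sub (t + L) t
    rw [add_sub_cancel_left, abs_of_pos hL0] at this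
    exact this
  calc |(|t + L| / L + (1 - 1 / L) * |t - L * round (t / L)|) - (|t| / L + (1 - 1 / L) * |t - L * round (t / L)|)|
      = |(|t + L| / L) - |t| / L| := by ring_nf
    _ ≤ 1 := e1

/-- **The two-scale code is dominated by ψ**: |round(t∕L)| + |t − L·round(t∕L)| ≤ 2ψ_L(t) + 1 for L ≥ 2.
[folklore] -/
theorem code_le_psi {L : ℝ} (hL : 2 ≤ L) (t : ℝ) :
    |(round (t / L) : ℝ)| + |t - L * round (t / L)| ≤ 2 * psi L t + 1 := by
  have hL0 : 0 < L := by linarith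
  set c : ℝ := (round (t / L) : ℝ) with hc
  set f : ℝ := t - L * round (t / L) with hf
  have hf2 : |f| ≤ L / 2 := by
    have h1 : |t / L - round (t / L)| ≤ 1 / 2 := abs_sub_round _
    have h2 : |f| = L * |t / L - round (t / L)| := by
      rw [hf, ← abs_of_pos hL0, ← abs_mul, abs_of_pos hL0]
      congr 1
      field_simp
    rw [h2]
    nlinarith
  have ht : L * |c| ≤ |t| + |f| := by
    have e : L * c = t - f := by rw [hf, hc]; ring
    have := abs_sub t f
    rw [← e, abs_mul, abs_of_pos hL0] at this
    exact this
  have hψ : psi L t = |t| / L + (1 - 1 / L) * |f| := rfl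
  -- (L − 2|f|) + |f|(L − 2) ≥ 0, i.e. L + |f|(L − 4) ≥ 0, is what makes the constant 1 suffice
  have h4 : 0 ≤ L + |f| * (L - 4) := by nlinarith [abs_nonneg f]
  have key : L * (|c| + |f|) ≤ L * (2 * psi L t + 1) := by
    have e : L * (2 * psi L t + 1) = 2 * |t| + 2 * (L - 1) * |f| + L := by
      rw [hψ]
      field_simp
    rw [e]
    nlinarith [abs_nonneg t, abs_nonneg f]
  exact le_of_mul_le_mul_left key hL0

variable {d a b : ℕ} [NeZero d]

/-- The relative integer coordinates of y seen from the base point s. [folklore] -/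
def tco (L : ℕ) (s y : TL d a b) (μ : Fin d) : ℤ := pos L y μ - pos L s μ

/-- The two-scale code of y relative to s: (round(t_μ∕L))_μ and (t_μ − L·round(t_μ∕L))_μ, a point of ℤ^{2d}. [folklore] -/
noncomputable def code (L : ℕ) (s y : TL d a b) : Fin d ⊕ Fin d → ℤ :=
  Sum.elim (fun μ => round ((tco L s y μ : ℝ) / L)) (fun μ => tco L s y μ - (L : ℤ) * round ((tco L s y μ : ℝ) / L))

/-- The total potential Ψ_s(y) = Σ_μ ψ_L(t_μ). [folklore] -/
noncomputable def Psi (L : ℕ) (s y : TL d a b) : ℝ := ∑ μ, psi L (tco L s y μ : ℝ)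

/-- Ψ_s(s) = 0. [folklore] -/
theorem Psi_self (L : ℕ) (s : TL d a b) : Psi L s s = 0 := by
  simp [Psi, tco, psi_zero]

/-- **Ψ changes by at most 1 along every bond** (one coordinate moves, by 1 or by L). [cite: Balaban1984PropagatorsII, (2.46) p.231] -/
theorem abs_Psi_sub_Psi_le_one {L : ℕ} (hL : 1 ≤ L) (s : TL d a b) {y y' : TL d a b} (h : (graph L).Adj y y') :
    |Psi L s y - Psi L s y'| ≤ 1 := by
  have hL' : (1 : ℝ) ≤ L := by exact_mod_cast hL
  obtain ⟨μ, h1, h2⟩ := pos_step h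
  have hν : ∀ ν, ν ≠ μ → tco L s y ν = tco L s y' ν := fun ν hν => by rw [tco, tco, h1 ν hν]
  unfold Psi
  rw [← Finset.sum_sub_distrib, Finset.sum_eq_single μ (fun ν _ hνμ => by rw [hν ν hνμ, sub_self])
    (fun hμ => absurd (Finset.mem_univ μ) hμ)]
  have hdiff : (tco L s y μ : ℝ) - (tco L s y' μ : ℝ) = ((pos L y μ - pos L y' μ : ℤ) : ℝ) := by
    simp only [tco]
    push_cast
    ring
  rcases h2 with h2 | h2
  · calc |psi L (tco L s y μ : ℝ) - psi L (tco L s y' μ : ℝ)|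
        ≤ |(tco L s y μ : ℝ) - (tco L s y' μ : ℝ)| := abs_psi_sub_psi_le hL' _ _
      _ = 1 := by rw [hdiff, ← Int.cast_abs, h2]; simp
  · -- the two positions differ by ± L
    have hL2 : ((pos L y μ - pos L y' μ : ℤ) : ℝ) = L ∨ ((pos L y μ - pos L y' μ : ℤ) : ℝ) = -L := by
      rcases abs_eq_abs.mp (show |((pos L y μ - pos L y' μ : ℤ) : ℝ)| = |(L : ℝ)| by
        rw [← Int.cast_abs, h2]; simp) with h3 | h3
      · exact Or.inl h3
      · exact Or.inr h3
    rcases hL2 with h3 | h3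
    · have e : (tco L s y μ : ℝ) = (tco L s y' μ : ℝ) + L := by linarith [hdiff]
      rw [e]
      exact abs_psi_add_sub_psi_le hL' _
    · have e : (tco L s y' μ : ℝ) = (tco L s y μ : ℝ) + L := by linarith [hdiff]
      rw [abs_sub_comm, e]
      exact abs_psi_add_sub_psi_le hL' _

/-- **Ψ_s(y) ≤ d(s, y)** (Ψ_s is a 1-Lipschitz potential vanishing at s). [cite: Balaban1984PropagatorsII, (2.46) p.231] -/
theorem Psi_le_tdist {L : ℕ} (hL : 1 ≤ L) (s y : TL d a b) : Psi L s y ≤ tdist L s y := by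
  have := abs_sub_le_mul_tdist L (Φ := Psi L s) (c := 1) (fun z z' h => abs_Psi_sub_Psi_le_one hL s h) s y
  rw [Psi_self, zero_sub, abs_neg, one_mul] at this
  exact (le_abs_self _).trans this

/-- **The code is controlled by the distance**: ‖code_s(y)‖₁ ≤ 2d(s, y) + d for L ≥ 2. [folklore] -/
theorem l1_code_le {L : ℕ} (hL : 2 ≤ L) (s y : TL d a b) : (l1 (code L s y) : ℝ) ≤ 2 * tdist L s y + d := by
  have hL' : (2 : ℝ) ≤ L := by exact_mod_cast hL
  have hL1 : 1 ≤ L := le_trans (by norm_num) hL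
  have e1 : (l1 (code L s y) : ℝ) = ∑ μ, (|(round ((tco L s y μ : ℝ) / L) : ℝ)| +
      |(tco L s y μ : ℝ) - L * round ((tco L s y μ : ℝ) / L)|) := by
    unfold l1
    push_cast
    rw [Fintype.sum_sum_type, ← Finset.sum_add_distrib]
    refine Finset.sum_congr rfl fun μ _ => ?_
    simp only [code, Sum.elim_inl, Sum.elim_inr]
    rw [Nat.cast_natAbs, Nat.cast_natAbs, Int.cast_abs, Int.cast_abs]
    push_cast
    rfl
  rw [e1]
  calc ∑ μ, (|(round ((tco L s y μ : ℝ) / L) : ℝ)| + |(tco L s y μ : ℝ) - L * round ((tco L s y μ : ℝ) / L)|)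
      ≤ ∑ μ : Fin d, (2 * psi L (tco L s y μ : ℝ) + 1) := Finset.sum_le_sum fun μ _ => code_le_psi hL' _
    _ = 2 * Psi L s y + d := by
        rw [Finset.sum_add_distrib, ← Finset.mul_sum, Finset.sum_const, Finset.card_univ, Fintype.card_fin]
        simp [Psi]
    _ ≤ 2 * tdist L s y + d := by linarith [Psi_le_tdist hL1 s y]

/-- The code determines the site. [folklore] -/
theorem code_injective {L : ℕ} (hL : 0 < L) (s : TL d a b) : Function.Injective (code L s) := by
  intro y y' h
  apply pos_injective hL
  funext μ
  have h1 := congr_fun h (Sum.inl μ)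
  have h2 := congr_fun h (Sum.inr μ)
  simp only [code, Sum.elim_inl, Sum.elim_inr] at h1 h2
  rw [h1] at h2
  have : tco L s y μ = tco L s y' μ := by linarith
  simp only [tco] at this
  linarith

/-- The (2.61)-profile of the model: K(a) = e^{ad∕2}·c₀(1, a∕2)^{2d}, INDEPENDENT of L, of the box sizes and of M.
[cite: Balaban1984PropagatorsII, (2.61) p.234; (2.58) p.233] -/
noncomputable def Ktl (d : ℕ) (a : ℝ) : ℝ := Real.exp (a * d / 2) * B6.c0 1 (a / 2) ^ (d + d)

/-- K(a) ≥ 0. [folklore] -/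
theorem Ktl_nonneg (d : ℕ) (a : ℝ) : 0 ≤ Ktl d a :=
  mul_nonneg (Real.exp_pos _).le (pow_nonneg (tsum_nonneg fun _ => (Real.exp_pos _).le) _)

/-- **The lattice sum on the two-level model**: Σ_y e^{−a·d(s, y)} ≤ K(a) for every base point s and every a > 0 —
the binder `hPr` (`B6DomainChange.Profile`) with an L-independent profile, by the injective two-scale code into ℤ^{2d}
and the counting lemma of Lemma 2.1′. [cite: Balaban1984PropagatorsII, (2.61) p.234; (2.58) p.233] -/
theorem sum_exp_neg_tdist_le {L : ℕ} (hL : 2 ≤ L) {a' : ℝ} (ha : 0 < a') (s : TL d a b) :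
    ∑ y, Real.exp (-(a' * tdist L s y)) ≤ Ktl d a' := by
  classical
  have hL0 : 0 < L := lt_of_lt_of_le (by norm_num) hL
  have h1 : ∀ y : TL d a b, Real.exp (-(a' * tdist L s y)) ≤
      Real.exp (a' * d / 2) * Real.exp (-(a' / 2 * 1 * (l1 (code L s y) : ℝ))) := by
    intro y
    rw [← Real.exp_add]
    apply Real.exp_le_exp.2
    have := l1_code_le hL s y
    nlinarith
  calc ∑ y, Real.exp (-(a' * tdist L s y))
      ≤ ∑ y, Real.exp (a' * d / 2) * Real.exp (-(a' / 2 * 1 * (l1 (code L s y) : ℝ))) := Finset.sum_le_sum fun y _ => h1 y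
    _ = Real.exp (a' * d / 2) * ∑ y, Real.exp (-(a' / 2 * 1 * (l1 (code L s y) : ℝ))) := by rw [Finset.mul_sum]
    _ ≤ Real.exp (a' * d / 2) * B6.c0 1 (a' / 2) ^ Fintype.card (Fin d ⊕ Fin d) := by
        refine mul_le_mul_of_nonneg_left ?_ (Real.exp_pos _).le
        exact sum_exp_le_c0_pow (by linarith) Finset.univ (code L s) ((code_injective hL0 s).injOn)
          (fun y => (l1 (code L s y) : ℝ)) (fun _ _ => le_rfl)
    _ = Ktl d a' := by rw [Fintype.card_sum, Fintype.card_fin, Ktl]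

end Count

/-! ## §4  The cover 𝒟 = 𝒟_j ∪ 𝒟_{j+1} of the two-level model and the partition of unity ACROSS THE INTERFACE -/

section Cover

variable {d nf nc a b : ℕ} [NeZero d]

/-- The index set of the cover: the centres k ∈ {0, …, n_f}^d of the M-lattice of the fine box (cubes of 𝒟_j, of size
2M·L^jη) and the centres k ∈ {0, …, n_c}^d of the M-lattice of the coarse box (cubes of 𝒟_{j+1}, of size 2M·L^{j+1}η).
[cite: Balaban1984PropagatorsII, p.229 before (2.36)] -/
abbrev Idx (d nf nc : ℕ) : Type := (Fin d → Fin (nf + 1)) ⊕ (Fin d → Fin (nc + 1))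

/-- The RESCALED profiles h̃_□ (*"rescale them to proper scales"*): a 𝒟_j-cube reads the fine frame of a site, a
𝒟_{j+1}-cube the coarse frame — of sites of BOTH levels. [cite: Balaban1984PropagatorsII, p.229 before (2.36)] -/
noncomputable def pre (m L : ℕ) : Idx d nf nc → TL d a b → ℝ
  | Sum.inl k, y => bump m k (ff L y)
  | Sum.inr k, y => bump m k (cf L y)

/-- y ∈ □_i (the 2M-cube of the cube's level, read in that level's frame). [cite: Balaban1984PropagatorsII, p.229 before (2.36)] -/
def InCube (m L : ℕ) : Idx d nf nc → TL d a b → Prop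
  | Sum.inl k, y => InCubeR m k (ff L y)
  | Sum.inr k, y => InCubeR m k (cf L y)

/-- y ∈ □̃_i (the 4M-cube *"containing □ in the middle"*, p. 235: *"or it intersects B^{j+1}(Λ_{j+1}) also"* — □̃ of a
cube near the interface contains sites of the other level). [cite: Balaban1984PropagatorsII, p.235 before (2.70)] -/
def InBig (m L : ℕ) : Idx d nf nc → TL d a b → Prop
  | Sum.inl k, y => InBigR m k (ff L y)
  | Sum.inr k, y => InBigR m k (cf L y)

/-- The multiplication operator □_i of (2.70)∕(2.82): the indicator of □_i. [cite: Balaban1984PropagatorsII, (2.70) p.235] -/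
noncomputable def cubeInd (m L : ℕ) (i : Idx d nf nc) (y : TL d a b) : ℝ := by
  classical exact if InCube m L i y then 1 else 0

/-- S(y) := Σ_{□ ∈ 𝒟_j ∪ 𝒟_{j+1}} h̃_□(y)² — the plain two-level square sum (it is 2, not 1, at the interface:
`sqS_corner_eq_two`). [cite: Balaban1984PropagatorsII, (2.36) p.229] -/
noncomputable def sqS (nf nc m L : ℕ) (y : TL d a b) : ℝ := ∑ i : Idx d nf nc, pre m L i y ^ 2

/-- **THE PARTITION OF UNITY OF THE MODEL**: h_□ := h̃_□ · S^{−1∕2} — the normalisation that makes the rescaled families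
of the two levels *"satisfy Σ_{□∈𝒟} h_□² = 1. (2.36)"* on the whole two-level carrier (the printed text asserts (2.36)
for the union without saying how the families are matched across ∂Λ_{j+1}; this is the model's explicit convention,
DIVERGENCE D-b06.38). [cite: Balaban1984PropagatorsII, (2.36) p.229] -/
noncomputable def hfun (nf nc m L : ℕ) (i : Idx d nf nc) (y : TL d a b) : ℝ := pre m L i y / Real.sqrt (sqS nf nc m L y)

/-- The zone N_i := {y : d(y, □̃_iᶜ) ≤ w}. [cite: Balaban1984PropagatorsII, p.235 before (2.70); (2.83) p.237] -/
noncomputable def zone (nf nc m L : ℕ) (w : ℝ) (i : Idx d nf nc) : Finset (TL d a b) := by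
  classical exact Finset.univ.filter fun y => ∃ z, ¬ InBig m L i z ∧ tdist L y z ≤ w

/-- h̃_□ ≥ 0. [cite: Balaban1984PropagatorsI, (1.118) p.36] -/
theorem pre_nonneg (m L : ℕ) (i : Idx d nf nc) (y : TL d a b) : 0 ≤ pre m L i y := by
  cases i with
  | inl k => exact bump_nonneg m k _
  | inr k => exact bump_nonneg m k _

/-- h̃_□ ≤ 1. [cite: Balaban1984PropagatorsI, (1.118) p.36] -/
theorem pre_le_one (m L : ℕ) (i : Idx d nf nc) (y : TL d a b) : pre m L i y ≤ 1 := by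
  cases i with
  | inl k => exact bump_le_one m k _
  | inr k => exact bump_le_one m k _

/-- supp h̃_□ ⊂ □. [cite: Balaban1984PropagatorsII, p.229 (2.36)] -/
theorem inCube_of_pre_ne_zero {m : ℕ} (hm : 0 < m) (L : ℕ) {i : Idx d nf nc} {y : TL d a b} (h : pre m L i y ≠ 0) :
    InCube m L i y := by
  cases i with
  | inl k => exact inCubeR_of_bump_ne_zero hm h
  | inr k => exact inCubeR_of_bump_ne_zero hm h

/-- The cube indicator takes the values 0, 1 (binder `hpf01`). [folklore] -/
theorem cubeInd_zero_or_one (m L : ℕ) (i : Idx d nf nc) (y : TL d a b) : cubeInd m L i y = 0 ∨ cubeInd m L i y = 1 := by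
  unfold cubeInd
  split_ifs
  · exact Or.inr rfl
  · exact Or.inl rfl

/-- The cube indicator is 1 on □. [folklore] -/
theorem cubeInd_eq_one {m L : ℕ} {i : Idx d nf nc} {y : TL d a b} (h : InCube m L i y) : cubeInd m L i y = 1 := by
  unfold cubeInd
  rw [if_pos h]

/-- A site where the cube indicator is non-zero lies in □. [folklore] -/
theorem inCube_of_cubeInd_ne_zero {m L : ℕ} {i : Idx d nf nc} {y : TL d a b} (h : cubeInd m L i y ≠ 0) :
    InCube m L i y := by
  by_contra h'
  apply h
  unfold cubeInd
  rw [if_neg h']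

/-- **Along one bond every h̃_□ moves by at most (3π∕2)·L∕M** (the frames move by ≤ L in ℓ¹).
[cite: Balaban1984PropagatorsII, p.238 before (2.85) «gives a factor O(M⁻¹)»] -/
theorem abs_pre_sub_le_of_adj {m L : ℕ} (hm : 0 < m) (hL : 1 ≤ L) (i : Idx d nf nc) {y y' : TL d a b}
    (h : (graph L).Adj y y') : |pre m L i y - pre m L i y'| ≤ 3 * π / 2 / m * L := by
  have hc : 0 ≤ 3 * π / 2 / (m : ℝ) := by positivity
  have hL' : (1 : ℝ) ≤ L := by exact_mod_cast hL
  cases i with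
  | inl k =>
    calc |bump m k (ff L y) - bump m k (ff L y')| ≤ 3 * π / 2 / m * ∑ μ, |ff L y μ - ff L y' μ| := abs_bump_sub_le hm k _ _
      _ ≤ 3 * π / 2 / m * L := mul_le_mul_of_nonneg_left (sum_abs_ff_sub_le_of_adj hL h) hc
  | inr k =>
    calc |bump m k (cf L y) - bump m k (cf L y')| ≤ 3 * π / 2 / m * ∑ μ, |cf L y μ - cf L y' μ| := abs_bump_sub_le hm k _ _
      _ ≤ 3 * π / 2 / m * 1 := mul_le_mul_of_nonneg_left (sum_abs_cf_sub_le_of_adj hL h) hc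
      _ ≤ 3 * π / 2 / m * L := mul_le_mul_of_nonneg_left hL' hc

/-- **Finite overlap of the two-level cover**: at most 2^d cubes of each level are non-zero at a site, n₀ = 2^d + 2^d.
[cite: Balaban1984PropagatorsII, p.229 before (2.36)] -/
theorem card_filter_pre_ne_zero_le {m : ℕ} (hm : 0 < m) (L : ℕ) (y : TL d a b) :
    (Finset.univ.filter fun i : Idx d nf nc => pre m L i y ≠ 0).card ≤ 2 ^ d + 2 ^ d := by
  classical
  rw [Finset.card_filter, Fintype.sum_sum_type]
  have h1 : (∑ k : Fin d → Fin (nf + 1), if pre m L (Sum.inl k : Idx d nf nc) y ≠ 0 then 1 else 0) ≤ 2 ^ d := by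
    rw [← Finset.card_filter]
    exact card_filter_bump_ne_zero_le hm (ff L y)
  have h2 : (∑ k : Fin d → Fin (nc + 1), if pre m L (Sum.inr k : Idx d nf nc) y ≠ 0 then 1 else 0) ≤ 2 ^ d := by
    rw [← Finset.card_filter]
    exact card_filter_bump_ne_zero_le hm (cf L y)
  exact add_le_add h1 h2

/-- The plain square sum splits by level. [folklore] -/
theorem sqS_eq (nf nc m L : ℕ) (y : TL d a b) : sqS nf nc m L y =
    (∑ k : Fin d → Fin (nf + 1), bump m k (ff L y) ^ 2) + ∑ k : Fin d → Fin (nc + 1), bump m k (cf L y) ^ 2 := by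
  rw [sqS, Fintype.sum_sum_type]
  rfl

/-- S ≤ 2 everywhere (each level's family has square sum ≤ 1 at every real frame). [cite: Balaban1984PropagatorsI, (1.118) p.36] -/
theorem sqS_le_two {m : ℕ} (hm : 0 < m) (nf nc L : ℕ) (y : TL d a b) : sqS nf nc m L y ≤ 2 := by
  rw [sqS_eq]
  linarith [sum_bump_sq_le_one (n := nf) hm (ff L y), sum_bump_sq_le_one (n := nc) hm (cf L y)]

/-- **1 ≤ S on the two-level carrier**: at a Λ_j-site the 𝒟_j-family alone has square sum exactly 1 ((1.118) in the
fine frame, x_μ ∈ [0, n_fM]), at a Λ_{j+1}-site the 𝒟_{j+1}-family has ((1.118) in the coarse frame, i_μ ∈ [0, n_cM]).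
[cite: Balaban1984PropagatorsI, (1.118) p.36] [cite: Balaban1984PropagatorsII, (2.36) p.229] -/
theorem one_le_sqS {m L : ℕ} (hm : 0 < m) (hL : 0 < L) (y : TL d (nf * m) (nc * m)) : 1 ≤ sqS nf nc m L y := by
  rw [sqS_eq]
  cases y with
  | inl x =>
    have h1 : ∑ k : Fin d → Fin (nf + 1), bump m k (ff L (Sum.inl x : TL d (nf * m) (nc * m))) ^ 2 = 1 := by
      refine sum_bump_sq_eq_one hm (fun μ => ?_) (fun μ => ?_)
      · rw [ff_inl]; exact Nat.cast_nonneg _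
      · rw [ff_inl]; exact_mod_cast Nat.lt_succ_iff.mp (x μ).isLt
    rw [h1]
    linarith [Finset.sum_nonneg fun (k : Fin d → Fin (nc + 1)) (_ : k ∈ Finset.univ) =>
      sq_nonneg (bump m k (cf L (Sum.inl x : TL d (nf * m) (nc * m))))]
  | inr i =>
    have h1 : ∑ k : Fin d → Fin (nc + 1), bump m k (cf L (Sum.inr i : TL d (nf * m) (nc * m))) ^ 2 = 1 := by
      refine sum_bump_sq_eq_one hm (fun μ => ?_) (fun μ => ?_)
      · rw [cf_inr hL]; exact Nat.cast_nonneg _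
      · rw [cf_inr hL]; exact_mod_cast Nat.lt_succ_iff.mp (i μ).isLt
    rw [h1]
    linarith [Finset.sum_nonneg fun (k : Fin d → Fin (nf + 1)) (_ : k ∈ Finset.univ) =>
      sq_nonneg (bump m k (ff L (Sum.inr i : TL d (nf * m) (nc * m))))]

/-- **THE OBSTRUCTION (census O-9 ∕ GAPS G-pv05-2) IN THE KERNEL**: the plain sum of the two rescaled families is 2,
not 1, at the interface corner (both the 𝒟_j-family and the 𝒟_{j+1}-family have square sum 1 there, once LM ≥ 3) — so
(2.36) for 𝒟 = ⋃_j 𝒟_j needs a matching convention, which the text leaves implicit.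
[cite: Balaban1984PropagatorsII, (2.36) p.229] -/
theorem sqS_corner_eq_two {m L : ℕ} (hm : 0 < m) (hLm : 3 ≤ L * m) :
    sqS nf nc m L (Sum.inl 0 : TL d (nf * m) (nc * m)) = 2 := by
  have hm' : (0 : ℝ) < m := by exact_mod_cast hm
  have hL0 : 0 < L := Nat.pos_of_ne_zero fun h => by subst h; simp at hLm
  have hL' : (0 : ℝ) < L := by exact_mod_cast hL0
  have hLm' : (3 : ℝ) ≤ (L : ℝ) * m := by exact_mod_cast hLm
  rw [sqS_eq]
  have h1 : ∑ k : Fin d → Fin (nf + 1), bump m k (ff L (Sum.inl 0 : TL d (nf * m) (nc * m))) ^ 2 = 1 := by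
    refine sum_bump_sq_eq_one hm (fun μ => ?_) (fun μ => ?_)
    · rw [ff_inl]; exact Nat.cast_nonneg _
    · rw [ff_inl]; simp; positivity
  -- the coarse frame of the fine corner is (−1∕L, 0, …, 0): inside the plateau of the coarse cube with centre 0
  have hcf : ∀ μ, cf L (Sum.inl 0 : TL d (nf * m) (nc * m)) μ = if μ = 0 then -1 / (L : ℝ) else 0 := by
    intro μ
    by_cases hμ : μ = 0
    · subst hμ; simp [cf, pos, zv]
    · simp [cf, pos, zv, hμ]
  have h2 : ∑ k : Fin d → Fin (nc + 1), bump m k (cf L (Sum.inl 0 : TL d (nf * m) (nc * m))) ^ 2 = 1 := by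
    rw [sum_bump_sq_eq_prod]
    refine Finset.prod_eq_one fun μ _ => ?_
    rw [sum_fin_prof_sq_eq hm, hcf μ]
    by_cases hμ : μ = 0
    · rw [if_pos hμ]
      -- Σ_j h(−1∕(LM) − j)² = h(−1∕(LM))² = 1
      rw [Finset.sum_range_succ']
      have hz : ∀ k ∈ Finset.range nc, prof (-1 / (L : ℝ) / m - ((k + 1 : ℕ) : ℝ)) ^ 2 = 0 := by
        intro k _
        have hk : (0 : ℝ) ≤ k := Nat.cast_nonneg k
        have hneg : -1 / (L : ℝ) / m ≤ 0 := by
          rw [div_nonpos_iff]; exact Or.inr ⟨by rw [div_nonpos_iff]; exact Or.inr ⟨by norm_num, hL'.le⟩, hm'.le⟩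
        have : 2 / 3 ≤ |-1 / (L : ℝ) / m - ((k + 1 : ℕ) : ℝ)| := by
          rw [abs_of_nonpos (by push_cast; linarith)]
          push_cast
          linarith
        rw [prof_of_le_abs this, zero_pow two_ne_zero]
      rw [Finset.sum_eq_zero hz, zero_add]
      simp only [Nat.cast_zero, sub_zero]
      have : |-1 / (L : ℝ) / m| ≤ 1 / 3 := by
        rw [abs_of_nonpos (by rw [div_nonpos_iff]; exact Or.inr ⟨by rw [div_nonpos_iff]; exact Or.inr ⟨by norm_num, hL'.le⟩, hm'.le⟩)]
        rw [div_div, neg_div, neg_neg, div_le_div_iff₀ (by positivity) (by norm_num)]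
        linarith
      rw [prof_of_abs_le this, one_pow]
    · rw [if_neg hμ, zero_div]
      have := sum_prof_sq_eq_one nc 0 le_rfl (Nat.cast_nonneg nc)
      simpa using this
  rw [h1, h2]
  norm_num

/-- **(2.36) on the two-level carrier**: Σ_{□ ∈ 𝒟_j ∪ 𝒟_{j+1}} h_□(y)² = 1 at every site (the binder `h236`).
[cite: Balaban1984PropagatorsII, (2.36) p.229] -/
theorem sum_hfun_sq {m L : ℕ} (hm : 0 < m) (hL : 0 < L) (y : TL d (nf * m) (nc * m)) :
    ∑ i, hfun nf nc m L i y ^ 2 = 1 := by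
  have hS : 1 ≤ sqS nf nc m L y := one_le_sqS hm hL y
  have hS0 : 0 < sqS nf nc m L y := by linarith
  simp only [hfun, div_pow, Real.sq_sqrt hS0.le, ← Finset.sum_div]
  rw [← sqS]
  exact div_self hS0.ne'

/-- h_□ ≥ 0 (binder `hph`). [cite: Balaban1984PropagatorsII, p.229 (2.36)] -/
theorem hfun_nonneg {m L : ℕ} (i : Idx d nf nc) (y : TL d a b) : 0 ≤ hfun nf nc m L i y :=
  div_nonneg (pre_nonneg m L i y) (Real.sqrt_nonneg _)

/-- supp h_□ = supp h̃_□ ⊂ □ (the binder `hhsq`, and with `hpfsq` the cube itself). [cite: Balaban1984PropagatorsII, p.229 (2.36)] -/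
theorem pre_ne_zero_of_hfun_ne_zero {m L : ℕ} {i : Idx d nf nc} {y : TL d a b} (h : hfun nf nc m L i y ≠ 0) :
    pre m L i y ≠ 0 := fun h0 => h (by rw [hfun, h0, zero_div])

/-- **□·h_□ = h_□** (the binder `hph`). [cite: Balaban1984PropagatorsII, (2.70) p.235; (2.82) p.237] -/
theorem cubeInd_mul_hfun {m : ℕ} (hm : 0 < m) (L : ℕ) (i : Idx d nf nc) (y : TL d a b) :
    cubeInd m L i y * hfun nf nc m L i y = hfun nf nc m L i y := by
  by_cases h : pre m L i y = 0
  · rw [hfun, h, zero_div, mul_zero]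
  · rw [cubeInd_eq_one (inCube_of_pre_ne_zero hm L h), one_mul]

/-- **The finite overlap of {h_□}** (the binder `hover`, n₀ = 2^d + 2^d). [cite: Balaban1984PropagatorsII, p.229 before (2.36)] -/
theorem card_filter_hfun_ne_zero_le {m : ℕ} (hm : 0 < m) (L : ℕ) (y : TL d a b) :
    (Finset.univ.filter fun i : Idx d nf nc => hfun nf nc m L i y ≠ 0).card ≤ 2 ^ d + 2 ^ d := by
  classical
  refine le_trans (Finset.card_le_card ?_) (card_filter_pre_ne_zero_le (nf := nf) (nc := nc) hm L y)
  intro i hi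
  rw [Finset.mem_filter] at hi ⊢
  exact ⟨hi.1, pre_ne_zero_of_hfun_ne_zero hi.2⟩

/-- |1∕√a − 1∕√b| ≤ |a − b|∕2 for a, b ≥ 1. [folklore] -/
theorem abs_inv_sqrt_sub_le {u v : ℝ} (hu : 1 ≤ u) (hv : 1 ≤ v) :
    |1 / Real.sqrt u - 1 / Real.sqrt v| ≤ |u - v| / 2 := by
  have hsu : 1 ≤ Real.sqrt u := Real.one_le_sqrt.2 hu
  have hsv : 1 ≤ Real.sqrt v := Real.one_le_sqrt.2 hv
  have hsu0 : 0 < Real.sqrt u := by linarith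
  have hsv0 : 0 < Real.sqrt v := by linarith
  have hp : 1 ≤ Real.sqrt u * Real.sqrt v := le_trans (by norm_num) (mul_le_mul hsu hsv zero_le_one (by linarith))
  have hD : 2 ≤ (Real.sqrt u + Real.sqrt v) * (Real.sqrt u * Real.sqrt v) := by
    nlinarith [mul_nonneg (sub_nonneg.2 (show (2 : ℝ) ≤ Real.sqrt u + Real.sqrt v by linarith)) (sub_nonneg.2 hp)]
  have hD0 : 0 < (Real.sqrt u + Real.sqrt v) * (Real.sqrt u * Real.sqrt v) := by linarith
  have key : (1 / Real.sqrt u - 1 / Real.sqrt v) * ((Real.sqrt u + Real.sqrt v) * (Real.sqrt u * Real.sqrt v)) = v - u := by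
    field_simp
    have e1 := Real.sq_sqrt (show (0 : ℝ) ≤ u by linarith)
    have e2 := Real.sq_sqrt (show (0 : ℝ) ≤ v by linarith)
    nlinarith [e1, e2]
  have e : 1 / Real.sqrt u - 1 / Real.sqrt v = (v - u) / ((Real.sqrt u + Real.sqrt v) * (Real.sqrt u * Real.sqrt v)) := by
    rw [eq_div_iff hD0.ne']
    exact key
  rw [e, abs_div, abs_of_pos hD0, abs_sub_comm]
  exact div_le_div_of_nonneg_left (abs_nonneg _) (by norm_num) hD

/-- **Along one bond every h_□ moves by at most (1 + 2^{d+2})·(3π∕2)·L∕M** — the numerator h̃_□ by λ = (3π∕2)L∕M, the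
normalisation S^{−1∕2} by ½|ΔS| ≤ ½·2^{d+2}·2λ (at most 2^{d+2} cubes are active at the two ends, each square moving
by ≤ 2λ). [cite: Balaban1984PropagatorsII, p.238 before (2.85) «An estimate of the terms with the commutator is even simpler and gives a factor O(M⁻¹)»] -/
theorem abs_hfun_sub_le_of_adj {m L : ℕ} (hm : 0 < m) (hL : 1 ≤ L) (i : Idx d nf nc) {y y' : TL d (nf * m) (nc * m)}
    (h : (graph L).Adj y y') :
    |hfun nf nc m L i y - hfun nf nc m L i y'| ≤ (1 + 2 ^ (d + 2)) * (3 * π / 2) * L / m := by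
  classical
  have hL0 : 0 < L := hL
  set lam : ℝ := 3 * π / 2 / m * L with hlam
  have hlam0 : 0 ≤ lam := by positivity
  set S := sqS nf nc m L y with hSdef
  set S' := sqS nf nc m L y' with hS'def
  have hS : 1 ≤ S := one_le_sqS hm hL0 y
  have hS' : 1 ≤ S' := one_le_sqS hm hL0 y'
  -- |S − S′| ≤ 2^{d+2}·2λ
  have hSS : |S - S'| ≤ (2 ^ (d + 2) : ℝ) * (2 * lam) := by
    have e : S - S' = ∑ i : Idx d nf nc, (pre m L i y ^ 2 - pre m L i y' ^ 2) := by
      rw [hSdef, hS'def, sqS, sqS, ← Finset.sum_sub_distrib]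
    rw [e]
    set A := Finset.univ.filter fun i : Idx d nf nc => pre m L i y ^ 2 - pre m L i y' ^ 2 ≠ 0 with hA
    have hterm : ∀ i : Idx d nf nc, |pre m L i y ^ 2 - pre m L i y' ^ 2| ≤ 2 * lam := by
      intro i
      rw [sq_sub_sq, abs_mul]
      have h1 : |pre m L i y + pre m L i y'| ≤ 2 := by
        rw [abs_of_nonneg (add_nonneg (pre_nonneg m L i y) (pre_nonneg m L i y'))]
        linarith [pre_le_one m L i y, pre_le_one m L i y']
      have h2 : |pre m L i y - pre m L i y'| ≤ lam := abs_pre_sub_le_of_adj hm hL i h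
      exact mul_le_mul h1 h2 (abs_nonneg _) (by norm_num)
    have hAcard : A.card ≤ 2 ^ (d + 2) := by
      have hsub : A ⊆ (Finset.univ.filter fun i : Idx d nf nc => pre m L i y ≠ 0) ∪
          (Finset.univ.filter fun i : Idx d nf nc => pre m L i y' ≠ 0) := by
        intro i hi
        rw [hA, Finset.mem_filter] at hi
        rw [Finset.mem_union, Finset.mem_filter, Finset.mem_filter]
        by_contra hcon
        rw [not_or] at hcon
        apply hi.2
        have e1 : pre m L i y = 0 := by
          by_contra h1; exact hcon.1 ⟨Finset.mem_univ _, h1⟩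
        have e2 : pre m L i y' = 0 := by
          by_contra h2; exact hcon.2 ⟨Finset.mem_univ _, h2⟩
        rw [e1, e2]
        ring
      calc A.card ≤ _ := Finset.card_le_card hsub
        _ ≤ _ := Finset.card_union_le _ _
        _ ≤ (2 ^ d + 2 ^ d) + (2 ^ d + 2 ^ d) :=
            add_le_add (card_filter_pre_ne_zero_le hm L y) (card_filter_pre_ne_zero_le hm L y')
        _ = 2 ^ (d + 2) := by ring
    calc |∑ i : Idx d nf nc, (pre m L i y ^ 2 - pre m L i y' ^ 2)|
        ≤ ∑ i : Idx d nf nc, |pre m L i y ^ 2 - pre m L i y' ^ 2| := Finset.abs_sum_le_sum_abs _ _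
      _ = ∑ i ∈ A, |pre m L i y ^ 2 - pre m L i y' ^ 2| := by
          rw [hA, Finset.sum_filter]
          refine Finset.sum_congr rfl fun i _ => ?_
          by_cases h0 : pre m L i y ^ 2 - pre m L i y' ^ 2 = 0
          · simp [h0]
          · simp [h0]
      _ ≤ A.card • (2 * lam) := (Finset.sum_le_card_nsmul _ _ _ fun i _ => hterm i)
      _ ≤ (2 ^ (d + 2) : ℝ) * (2 * lam) := by
          rw [nsmul_eq_mul]
          exact mul_le_mul_of_nonneg_right (by exact_mod_cast hAcard) (by positivity)
  -- |a∕√S − a′∕√S′| ≤ |a − a′|∕√S + a′·|1∕√S − 1∕√S′| ≤ λ + ½|S − S′|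
  have hsqS : 1 ≤ Real.sqrt S := Real.one_le_sqrt.2 hS
  have ha' := pre_nonneg m L i y'
  have ha'1 := pre_le_one m L i y'
  have e : hfun nf nc m L i y - hfun nf nc m L i y' =
      (pre m L i y - pre m L i y') / Real.sqrt S + pre m L i y' * (1 / Real.sqrt S - 1 / Real.sqrt S') := by
    simp only [hfun, ← hSdef, ← hS'def]
    ring
  rw [e]
  calc |(pre m L i y - pre m L i y') / Real.sqrt S + pre m L i y' * (1 / Real.sqrt S - 1 / Real.sqrt S')|
      ≤ |(pre m L i y - pre m L i y') / Real.sqrt S| + |pre m L i y' * (1 / Real.sqrt S - 1 / Real.sqrt S')| :=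
        abs_add_le _ _
    _ ≤ lam + 1 * (|S - S'| / 2) := by
        refine add_le_add ?_ ?_
        · rw [abs_div, abs_of_pos (show (0 : ℝ) < Real.sqrt S by linarith)]
          calc |pre m L i y - pre m L i y'| / Real.sqrt S ≤ |pre m L i y - pre m L i y'| / 1 :=
              div_le_div_of_nonneg_left (abs_nonneg _) one_pos hsqS
            _ ≤ lam := by rw [div_one]; exact abs_pre_sub_le_of_adj hm hL i h
        · rw [abs_mul, abs_of_nonneg ha']
          exact mul_le_mul ha'1 (abs_inv_sqrt_sub_le hS hS') (abs_nonneg _) zero_le_one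
    _ ≤ lam + 2 ^ (d + 2) * lam := by linarith
    _ = (1 + 2 ^ (d + 2)) * (3 * π / 2) * L / m := by rw [hlam]; ring

/-- **The Lipschitz bound (binder `hLip`) on the two-level carrier**: |h_□(y) − h_□(y″)| ≤ s∕M · d(y, y″) with
s = (1 + 2^{d+2})·(3π∕2)·L — h_□ is Lipschitz, which is all the first-order expansion (2.83) uses of *"h ∈ C₀^∞"*.
[cite: Balaban1984PropagatorsII, p.238 before (2.85) «gives a factor O(M⁻¹)»; (2.85)] -/
theorem abs_hfun_sub_le {m L : ℕ} (hm : 0 < m) (hL : 1 ≤ L) (i : Idx d nf nc) (y y'' : TL d (nf * m) (nc * m)) :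
    |hfun nf nc m L i y - hfun nf nc m L i y''| ≤ (1 + 2 ^ (d + 2)) * (3 * π / 2) * L / m * tdist L y y'' :=
  abs_sub_le_mul_tdist L (Φ := fun z => hfun nf nc m L i z) (fun _ _ h => abs_hfun_sub_le_of_adj hm hL i h) y y''

/-- **The support gap (binder `hgap`) on the two-level carrier**: □_i y = 0 and h_i(y″) ≠ 0 ⟹ d(y, y″) ≥ M∕(3L) (a frame
coordinate differs by > M∕3 and frames are L-Lipschitz in d). [cite: Balaban1984PropagatorsII, p.229 (2.36); p.237 (2.83)] -/
theorem gap_of_cubeInd_eq_zero {m L : ℕ} (hm : 0 < m) (hL : 1 ≤ L) {i : Idx d nf nc} {y y'' : TL d a b}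
    (hy : cubeInd m L i y = 0) (hy'' : hfun nf nc m L i y'' ≠ 0) : 1 / (3 * (L : ℝ)) * m ≤ tdist L y y'' := by
  have hL' : (0 : ℝ) < L := by exact_mod_cast hL
  have hnot : ¬ InCube m L i y := fun h => by rw [cubeInd_eq_one h] at hy; exact one_ne_zero hy
  have hpre := pre_ne_zero_of_hfun_ne_zero hy''
  have key : 1 / 3 * (m : ℝ) < L * tdist L y y'' := by
    cases i with
    | inl k =>
      obtain ⟨μ, hμ⟩ := exists_gt_of_not_inCubeR hm hnot hpre
      exact lt_of_lt_of_le hμ (abs_ff_sub_le hL y y'' μ)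
    | inr k =>
      obtain ⟨μ, hμ⟩ := exists_gt_of_not_inCubeR hm hnot hpre
      exact lt_of_lt_of_le hμ (abs_cf_sub_le hL y y'' μ)
  rw [show 1 / (3 * (L : ℝ)) * m = (1 / 3 * (m : ℝ)) / L by field_simp, div_le_iff₀ hL']
  linarith

/-- **The collar (binder `hcollar`) on the two-level carrier**: y ∈ □_i, z ∉ □̃_i ⟹ d(y, z) ≥ M∕L.
[cite: Balaban1984PropagatorsII, p.235 before (2.70)] -/
theorem collar {m L : ℕ} (hL : 1 ≤ L) {i : Idx d nf nc} {y z : TL d a b} (hy : InCube m L i y) (hz : ¬ InBig m L i z) :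
    (m : ℝ) / L ≤ tdist L y z := by
  have hL' : (0 : ℝ) < L := by exact_mod_cast hL
  have key : (m : ℝ) < L * tdist L y z := by
    cases i with
    | inl k =>
      obtain ⟨μ, hμ⟩ := exists_gt_of_not_inBigR hy hz
      exact lt_of_lt_of_le hμ (abs_ff_sub_le hL y z μ)
    | inr k =>
      obtain ⟨μ, hμ⟩ := exists_gt_of_not_inBigR hy hz
      exact lt_of_lt_of_le hμ (abs_cf_sub_le hL y z μ)
  rw [div_le_iff₀ hL']
  linarith

/-- Membership in the zone N_□ (the binder `hzone` holds by construction). [folklore] -/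
theorem mem_zone {nf nc m L : ℕ} {w : ℝ} {i : Idx d nf nc} {y : TL d a b} :
    y ∈ zone nf nc m L w i ↔ ∃ z, ¬ InBig m L i z ∧ tdist L y z ≤ w := by
  unfold zone
  simp only [Finset.mem_filter, Finset.mem_univ, true_and]

/-- A frame point far from the centre in coordinate 0 is outside □̃. [folklore] -/
theorem not_inBigR_of_far {m C : ℕ} (hm : 0 < m) {n : ℕ} (hn : 5 ≤ n) (k : Fin d → Fin C)
    {p q : Fin d → ℝ} (hp : p 0 = n * m) (hq : q 0 = 0) : ¬ InBigR m k p ∨ ¬ InBigR m k q := by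
  have hm' : (0 : ℝ) < m := by exact_mod_cast hm
  have hn' : (5 : ℝ) ≤ n := by exact_mod_cast hn
  by_cases hk2 : (k 0 : ℕ) ≤ 2
  · left
    intro h
    have h0 := h 0
    rw [hp, ctr] at h0
    have hk' : ((k 0 : ℕ) : ℝ) ≤ 2 := by exact_mod_cast hk2
    have h1 : (n : ℝ) * m - ((k 0 : ℕ) : ℝ) * m ≤ 2 * m := le_trans (le_abs_self _) h0
    have h2 : 3 * (m : ℝ) ≤ ((n : ℝ) - ((k 0 : ℕ) : ℝ)) * m := mul_le_mul_of_nonneg_right (by linarith) hm'.le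
    nlinarith
  · right
    intro h
    have h0 := h 0
    rw [hq, ctr, zero_sub, abs_neg, abs_of_nonneg (by positivity)] at h0
    have hk' : (3 : ℝ) ≤ ((k 0 : ℕ) : ℝ) := by exact_mod_cast (by omega : 3 ≤ (k 0 : ℕ))
    nlinarith

/-- **The zones are non-empty (binder `hN`)**: every □̃ misses a site of its own level (n_f, n_c ≥ 5).
[cite: Balaban1984PropagatorsII, p.235 before (2.70)] -/
theorem zone_nonempty {m L : ℕ} (hm : 0 < m) (hL : 0 < L) (hnf : 5 ≤ nf) (hnc : 5 ≤ nc) {w : ℝ} (hw : 0 ≤ w)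
    (i : Idx d nf nc) : (zone nf nc m L w i : Finset (TL d (nf * m) (nc * m))).Nonempty := by
  obtain ⟨z, hz⟩ : ∃ z : TL d (nf * m) (nc * m), ¬ InBig m L i z := by
    cases i with
    | inl k =>
      rcases not_inBigR_of_far hm hnf k
          (p := ff L (Sum.inl (fun _ => Fin.last (nf * m)) : TL d (nf * m) (nc * m)))
          (q := ff L (Sum.inl (fun _ => 0) : TL d (nf * m) (nc * m)))
          (by rw [ff_inl]; simp) (by rw [ff_inl]; simp) with h | h
      · exact ⟨_, h⟩
      · exact ⟨_, h⟩
    | inr k =>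
      rcases not_inBigR_of_far hm hnc k
          (p := cf L (Sum.inr (fun _ => Fin.last (nc * m)) : TL d (nf * m) (nc * m)))
          (q := cf L (Sum.inr (fun _ => 0) : TL d (nf * m) (nc * m)))
          (by rw [cf_inr hL]; simp) (by rw [cf_inr hL]; simp) with h | h
      · exact ⟨_, h⟩
      · exact ⟨_, h⟩
  exact ⟨z, mem_zone.mpr ⟨z, hz, by rw [tdist_self]; exact hw⟩⟩

end Cover

/-! ## §5  The two-level geometry `tlGeo` and its metric binders (hρ, (2.54), hsep, (2.60), (2.61), (2.63)) -/

section Geo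

variable (d : ℕ) [NeZero d] (nf nc m L j kk : ℕ) (η R : ℝ)

/-- **The coordinatised two-level geometry**: 𝔅 = a box of Λ_j (n_f^d big blocks of size M = m Λ_j-bonds, scale j)
glued along the face {x₀ = 0} ∕ {x₀ = −1} to a box of Λ_{j+1} (n_c^d big blocks of size M Λ_{j+1}-bonds, scale j + 1,
spacing L ∈ ℕ in Λ_j-units); d = the number of bonds of a shortest admissible contour ((2.46), every bond weighing 1);
k, η, R free, M = m; the localisation vocabulary trivial (not used by the Proposition 2.3 chain).
[cite: Balaban1984PropagatorsII, (2.1)–(2.4) p.224; p.229 before (2.36); (2.46) p.231] -/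
@[reducible] noncomputable def tlGeo : B6.Geometry where
  Site := TL d (nf * m) (nc * m)
  fin := inferInstance
  scale := fun y => Sum.elim (fun _ => j) (fun _ => j + 1) y
  dist := tdist L
  k := kk
  eta := η
  L := L
  R := R
  M := m
  Hyp21_22 := True
  Loc := PUnit
  suppIn := fun _ _ => True
  supNorm := fun _ => 0
  l2Norm := fun _ => 0
  holder := fun _ _ => 0
  Cut := PUnit
  cutIn := fun _ _ => True
  cutH := fun _ _ => 0
  cutSup := fun _ => 0

/-- hρ on the two-level model. [folklore] -/
theorem tlGeo_isPseudoDist : IsPseudoDist (tlGeo d nf nc m L j kk η R).dist := isPseudoDist_tdist L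

/-- (2.54) on the model. [cite: Balaban1984PropagatorsII, (2.54) p.233] -/
theorem tlGeo_triangle : Triangle254 (tlGeo d nf nc m L j kk η R) := fun a b c => tdist_triangle L a b c

/-- Two adjacent scales: |j(y) − j(y′)| ≤ 1, so max{|j − j′| − 1, 0} = 0. [cite: Balaban1984PropagatorsII, (2.60) p.234] -/
theorem tlGeo_mx_eq_zero (y y' : (tlGeo d nf nc m L j kk η R).Site) : mx (tlGeo d nf nc m L j kk η R) y y' = 0 := by
  have h : |((tlGeo d nf nc m L j kk η R).scale y : ℝ) - (tlGeo d nf nc m L j kk η R).scale y'| ≤ 1 := by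
    rcases y with x | i <;> rcases y' with x' | i' <;> simp
  unfold mx
  exact max_eq_right (by linarith)

/-- **hsep on two adjacent levels**: max{|j − j′| − 1, 0} = 0, so RM·0 ≤ d. [cite: Balaban1984PropagatorsII, (2.60) p.234] -/
theorem tlGeo_levelSep : LevelSep (tlGeo d nf nc m L j kk η R) := by
  intro y y'
  rw [tlGeo_mx_eq_zero, mul_zero]
  exact tdist_nonneg L y y'

/-- **(2.60) on two adjacent levels**: its right side is e⁰ = 1 (the binder `h260`). [cite: Balaban1984PropagatorsII, (2.60) p.234] -/
theorem tlGeo_ineq260 {δ₀ α' : ℝ} (hα' : 0 ≤ α' * δ₀) : Ineq260 (tlGeo d nf nc m L j kk η R) δ₀ α' := by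
  intro y y'
  have hmax : max (|((tlGeo d nf nc m L j kk η R).scale y : ℝ) - (tlGeo d nf nc m L j kk η R).scale y'| - 1) 0 = 0 :=
    tlGeo_mx_eq_zero d nf nc m L j kk η R y y'
  rw [hmax, mul_zero, neg_zero, Real.exp_zero]
  apply Real.exp_le_one_iff.mpr
  have h1 : 0 ≤ α' * δ₀ * tdist L y y' := mul_nonneg hα' (tdist_nonneg L y y')
  show -(α' * δ₀ * tdist L y y') ≤ 0
  linarith

/-- **The (2.61)-profile of the model (binders `hPr`, `hK`)**, for L ≥ 2. [cite: Balaban1984PropagatorsII, (2.61) p.234] -/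
theorem tlGeo_profile (hL : 2 ≤ L) : Profile (tlGeo d nf nc m L j kk η R).dist (fun a => a) (Ktl d) :=
  fun _ ha s => sum_exp_neg_tdist_le hL ha s

/-- **(2.61) with the constant K(αδ₀) on the model** (the binders `h261σ`, `h261`). [cite: Balaban1984PropagatorsII, (2.61) p.234] -/
theorem tlGeo_ineq261With (hL : 2 ≤ L) {δ₀ α : ℝ} (h : 0 < α * δ₀) :
    Ineq261With (Ktl d (α * δ₀)) (tlGeo d nf nc m L j kk η R) δ₀ α :=
  fun y => tlGeo_profile d nf nc m L j kk η R hL (α * δ₀) h y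

/-- **(2.63) with the constant K(αδ₀) on the model** (the binder `h263`), from (2.61)′ and (2.54) by the tree's
`B6Lemma21Repaired.ineq263With_of_261With`. [cite: Balaban1984PropagatorsII, (2.63) p.234] -/
theorem tlGeo_ineq263With (hL : 2 ≤ L) {δ₀ α : ℝ} (h : 0 < α * δ₀) (hδ : 0 ≤ δ₀) (hα : α ≤ 1) :
    Ineq263With (Ktl d (α * δ₀)) (tlGeo d nf nc m L j kk η R) δ₀ α :=
  B6Lemma21Repaired.ineq263With_of_261With (tlGeo_triangle d nf nc m L j kk η R) hδ hα
    (tlGeo_ineq261With d nf nc m L j kk η R hL h)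

end Geo

/-! ## §6  Proposition 2.3 on the two-level model: the cover ∕ cube ∕ collar ∕ zone ∕ metric binders discharged -/

section Edge

variable (d : ℕ) [NeZero d] (nf nc m L j kk : ℕ) (η R : ℝ)

/-- **PROPOSITION 2.3 ON THE COORDINATISED TWO-LEVEL COVER** — `B6Prop23CubeDepth.prop23_assembled_fine_twoLevel_cubes`
(p. 238 before (2.85) ⟹ (2.85) ⟹ Lemma 2.1 ⟹ (2.86)–(2.87), change-of-domain input and depth binders discharged upstream)
ON the two-level geometry `tlGeo d nf nc m L j kk η R` with the cover 𝒟 = 𝒟_j ∪ 𝒟_{j+1}: □_i := the indicator `cubeInd m L i`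
of the 2M-cube of the cube's own level read in that level's frame (i ∈ {0, …, n_f}^d ⊕ {0, …, n_c}^d), h_i := `hfun nf nc m L i`
= h̃_i·S^{−1∕2} (h̃_i = Π_μ h((p_μ − i_μM)∕M) in the cube's frame, [B5] (1.118) *"rescaled to proper scales"*, S = Σ h̃²),
j_□ := j for every cube, □̃_i := the 4M-cube `InBig m L i` (which near the interface *"intersects B^{j+1}(Λ_{j+1}) also"*),
N_i := `zone nf nc m L w i`; the binders hρ, hsep, hM, h260, hK, hPr, h261σ, h261, h263, hc, hs, hmg, hover (n₀ = 2^d + 2^d),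
hpf01, hph, h236, hLip (s = (1 + 2^{d+2})·(3π∕2)·L), hcube, hgap (m_g = 1∕(3L)), hN, hκ (κ = 1∕(2L)), hpfsq, hhsq, hcollar
(M_c = M∕L), hzone, hdepth are DISCHARGED by §§2–5; the model needs d ≥ 1, M ≥ 1, n_f, n_c ≥ 5, L ∈ ℕ with L ≥ 2 and a
zone width 0 ≤ w with 2wL ≤ M.  Kept VERBATIM (with these substitutions): the sizes of η, R (hη, hRM, hsize, hthr), the
rates (hα′, hκδ, hB₁, hθ, hsplit; the two (2.61)-constants are K(σ(δ − α′δ₀)∕3) and K(δ₁∕2), so 0 < σ(δ − α′δ₀)∕3 and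
0 < δ₁ are assumed), the kernels X, X̃_i, C_i with (2.76)-type bounds hX ∕ hXw, (2.81) h281 (at the fine scale L^jη for
every cube), hCk0, (2.70) h270, the fine-lattice data blk, χ_i, D_i, G′, G′(□̃_i) with hχ1, hpfχ, hhχ, hχN, hGD, hDG, hχGw,
hGwχ and the majorants hG, hGw, hKGw, hKG, the Q′-data, the dictionary hXdef ∕ hXwdef, and «M large» hKM (with the
model's n₀, s, c_σ = K(σ(δ − α′δ₀)∕3), c₃ = ((δ − α′δ₀)∕3)·(1∕(2L)), m_g = 1∕(3L), c = K(δ₁∕2)); conclusion verbatim: the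
two-sided inverse of Q′G′²Q′* in the pairing (2.69), its glued form (2.86), uniqueness, and (2.87) with the same O(1).
[cite: Balaban1984PropagatorsII, Proposition 2.3 (2.85)–(2.87) p.238; (2.36) p.229; p.235 before (2.70)] -/
theorem prop23_assembled_twoLevelBox (hm : 0 < m) (hnf : 5 ≤ nf) (hnc : 5 ≤ nc) (hL2 : 2 ≤ L) (hη : 0 < η)
    (hRM : 0 ≤ R * m)
    {X : Type}
    -- the fine-lattice side: blocks, the located size condition
    (blk : X → (tlGeo d nf nc m L j kk η R).Site) {δ₀ α' : ℝ} (hα' : 0 ≤ α' * δ₀)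
    (hsize : (L : ℝ) ^ 2 * Real.exp (-(α' * δ₀ * (R * m))) ≤ 1)
    {δ B₁ θ : ℝ} (hκδ : α' * δ₀ < δ) (hB₁ : 0 ≤ B₁) (hθ : 0 ≤ θ)
    -- the rates of the assembled Prop. 2.3 (its δ₀ is (δ − α′δ₀)/3)
    {δ₁ σ BX BC : ℝ} (hδ₁ : 0 < δ₁) (hsplit : δ₁ + σ * ((δ - α' * δ₀) / 3) ≤ (δ - α' * δ₀) / 3 / 4)
    (hσ : 0 < σ * ((δ - α' * δ₀) / 3))
    (hthr : (L : ℝ) ^ 4 ≤ Real.exp (1 / 8 * ((δ - α' * δ₀) / 3) * R * m))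
    (hBX : 0 ≤ BX) (hBC : 0 ≤ BC)
    -- the kernels X, X̃_i, C_i in the pairing (2.69)
    {Xk : (tlGeo d nf nc m L j kk η R).Site → (tlGeo d nf nc m L j kk η R).Site → ℝ}
    {Xwk Ck : Idx d nf nc → (tlGeo d nf nc m L j kk η R).Site → (tlGeo d nf nc m L j kk η R).Site → ℝ}
    (hX : ∀ y y'', |(tlGeo d nf nc m L j kk η R).len y'' ^ d * Xk y y''| ≤
      BX * (tlGeo d nf nc m L j kk η R).len y ^ 4 *
        Real.exp (-(1 / 2 * ((δ - α' * δ₀) / 3) * (tlGeo d nf nc m L j kk η R).dist y y'')))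
    (hXw : ∀ i y y'', |(tlGeo d nf nc m L j kk η R).len y'' ^ d * Xwk i y y''| ≤
      BX * (tlGeo d nf nc m L j kk η R).len y ^ 4 *
        Real.exp (-(1 / 2 * ((δ - α' * δ₀) / 3) * (tlGeo d nf nc m L j kk η R).dist y y'')))
    (h281 : ∀ i y y', cubeInd m L i y ≠ 0 → cubeInd m L i y' ≠ 0 →
      |Ck i y y'| ≤
        BC / ((tlGeo d nf nc m L j kk η R).L ^ j * (tlGeo d nf nc m L j kk η R).eta) ^ (d + 4) *
          Real.exp (-(δ₁ * (tlGeo d nf nc m L j kk η R).dist y y')))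
    (hCk0 : ∀ i y'' y', cubeInd m L i y'' = 0 → Ck i y'' y' = 0)
    (h270 : ∀ i, locOp (fun i => B6Expansion282.mulOp (cubeInd m L i))
        (fun i => kerOp (fun z => (tlGeo d nf nc m L j kk η R).len z ^ d) (Xwk i)) i *
      kerOp (fun z => (tlGeo d nf nc m L j kk η R).len z ^ d) (Ck i) * B6Expansion282.mulOp (hfun nf nc m L i) =
        B6Expansion282.mulOp (hfun nf nc m L i))
    -- the fine-lattice data of each cube: cut-off χ_i, D_i, G′(□̃_i) = Gw i; G′ = G, Q′ = Qp, Q′* = Qs; zone width w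
    {w : ℝ} (hw0 : 0 ≤ w) (hw : 2 * w * L ≤ m)
    {G : Module.End ℝ (X → ℝ)} {Dop Gw : Idx d nf nc → Module.End ℝ (X → ℝ)}
    {χ : Idx d nf nc → X → ℝ}
    (hχ1 : ∀ i x, |χ i x| ≤ 1)
    (hpfχ : ∀ i x, cubeInd m L i (blk x) * χ i x = cubeInd m L i (blk x))
    (hhχ : ∀ i x, χ i x * hfun nf nc m L i (blk x) = hfun nf nc m L i (blk x))
    (hχN : ∀ i x, blk x ∉ zone nf nc m L w i → χ i x = 1)
    (hGD : ∀ i, G * Dop i = 1) (hDG : ∀ i, Dop i * G = 1)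
    (hχGw : ∀ i, B9Thm37Sum.mulOp (χ i) * Dop i * Gw i = B9Thm37Sum.mulOp (χ i))
    (hGwχ : ∀ i, Gw i * Dop i * B9Thm37Sum.mulOp (χ i) = B9Thm37Sum.mulOp (χ i))
    (hG : HasMajorant blk G (fun a b => B₁ * (tlGeo d nf nc m L j kk η R).len a ^ 2 *
      Real.exp (-(δ * (tlGeo d nf nc m L j kk η R).dist a b))))
    (hGw : ∀ i, HasMajorant blk (Gw i) (fun a b => B₁ * (tlGeo d nf nc m L j kk η R).len a ^ 2 *
      Real.exp (-(δ * (tlGeo d nf nc m L j kk η R).dist a b))))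
    (hKGw : ∀ i, HasMajorant blk ((B9Thm37Sum.mulOp (χ i) * Dop i - Dop i * B9Thm37Sum.mulOp (χ i)) * Gw i)
      (fun a b => (if a ∈ zone nf nc m L w i then θ else 0) * Real.exp (-(δ * (tlGeo d nf nc m L j kk η R).dist a b))))
    (hKG : ∀ i, HasMajorant blk ((B9Thm37Sum.mulOp (χ i) * Dop i - Dop i * B9Thm37Sum.mulOp (χ i)) * G)
      (fun a b => (if a ∈ zone nf nc m L w i then θ else 0) * Real.exp (-(δ * (tlGeo d nf nc m L j kk η R).dist a b))))
    -- the Q′-data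
    {Qp : (X → ℝ) →ₗ[ℝ] ((tlGeo d nf nc m L j kk η R).Site → ℝ)} {Qs : ((tlGeo d nf nc m L j kk η R).Site → ℝ) →ₗ[ℝ] (X → ℝ)}
    {cQ cQs : ℝ} (hcQ : 0 ≤ cQ) (hcQs : 0 ≤ cQs)
    (hQ : HasMajorantHom blk (fun y : (tlGeo d nf nc m L j kk η R).Site => y) Qp
      (fun (a b : (tlGeo d nf nc m L j kk η R).Site) => cQ * (if a = b then (1 : ℝ) else 0)))
    (hQs : HasMajorantHom (fun y : (tlGeo d nf nc m L j kk η R).Site => y) blk Qs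
      (fun (a b : (tlGeo d nf nc m L j kk η R).Site) => cQs * (if a = b then (1 : ℝ) else 0)))
    (hQχ : ∀ i : Idx d nf nc, (B9Thm37Sum.mulOp (cubeInd m L i) : Module.End ℝ ((tlGeo d nf nc m L j kk η R).Site → ℝ)) ∘ₗ Qp =
      Qp ∘ₗ (B9Thm37Sum.mulOp (cubeInd m L i ∘ blk) : Module.End ℝ (X → ℝ)))
    (hQsh : ∀ i : Idx d nf nc, Qs ∘ₗ (B9Thm37Sum.mulOp (hfun nf nc m L i) : Module.End ℝ ((tlGeo d nf nc m L j kk η R).Site → ℝ)) =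
      (B9Thm37Sum.mulOp (hfun nf nc m L i ∘ blk) : Module.End ℝ (X → ℝ)) ∘ₗ Qs)
    -- the dictionary (definitions of X, X̃_i as the (2.69)-kernels of Q′G′²Q′*, Q′G′(□̃_i)²Q′*)
    (hXdef : kerOp (fun z => (tlGeo d nf nc m L j kk η R).len z ^ d) Xk = Qp ∘ₗ (G * G) ∘ₗ Qs)
    (hXwdef : ∀ i, kerOp (fun z => (tlGeo d nf nc m L j kk η R).len z ^ d) (Xwk i) = Qp ∘ₗ (Gw i * Gw i) ∘ₗ Qs)
    -- «M large enough», with the model's constants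
    (hKM : 2 * K285TL (tlGeo d nf nc m L j kk η R) d (2 ^ d + 2 ^ d) ((1 + 2 ^ (d + 2)) * (3 * π / 2) * L) ((δ - α' * δ₀) / 3)
      (Ktl d (σ * ((δ - α' * δ₀) / 3))) ((δ - α' * δ₀) / 3 * (1 / (2 * (L : ℝ)))) (1 / (3 * (L : ℝ))) BX
      (cQ * cQs * ((tlGeo d nf nc m L j kk η R).L ^ 2 * Ctot (Ktl d) B₁ θ (δ - α' * δ₀))) BC *
      Ktl d (1 / 2 * δ₁) ≤ (tlGeo d nf nc m L j kk η R).M) :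
    ∃ Ginv : Module.End ℝ ((tlGeo d nf nc m L j kk η R).Site → ℝ),
      Ginv * kerOp (fun z => (tlGeo d nf nc m L j kk η R).len z ^ d) Xk = 1 ∧
      kerOp (fun z => (tlGeo d nf nc m L j kk η R).len z ^ d) Xk * Ginv = 1 ∧
      Ginv = Cglued (fun i => B6Expansion282.mulOp (hfun nf nc m L i))
          (fun i => kerOp (fun z => (tlGeo d nf nc m L j kk η R).len z ^ d) (Ck i)) +
        Ginv * R282 (kerOp (fun z => (tlGeo d nf nc m L j kk η R).len z ^ d) Xk) (fun i => B6Expansion282.mulOp (cubeInd m L i))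
          (fun i => kerOp (fun z => (tlGeo d nf nc m L j kk η R).len z ^ d) (Xwk i)) (fun i => B6Expansion282.mulOp (hfun nf nc m L i))
          (fun i => kerOp (fun z => (tlGeo d nf nc m L j kk η R).len z ^ d) (Ck i)) ∧
      (∀ G' : Module.End ℝ ((tlGeo d nf nc m L j kk η R).Site → ℝ),
        G' * kerOp (fun z => (tlGeo d nf nc m L j kk η R).len z ^ d) Xk = 1 → G' = Ginv) ∧
      ∀ y y', |mat Ginv y y' / (tlGeo d nf nc m L j kk η R).len y' ^ d| ≤
        2 * ((2 ^ d + 2 ^ d : ℕ) * (BC * (tlGeo d nf nc m L j kk η R).L ^ (d + 4))) * Ktl d (1 / 2 * δ₁) *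
          (tlGeo d nf nc m L j kk η R).len y ^ (-(4 : ℝ)) *
          (tlGeo d nf nc m L j kk η R).len y' ^ (-(d : ℝ)) * Real.exp (-(δ₁ / 2 * (tlGeo d nf nc m L j kk η R).dist y y')) := by
  have hL1 : 1 ≤ L := le_trans (by norm_num) hL2
  have hL0 : 0 < L := hL1
  have hLr : (1 : ℝ) ≤ (L : ℝ) := by exact_mod_cast hL1
  have hLr0 : (0 : ℝ) < (L : ℝ) := by exact_mod_cast hL0
  have hM : 0 < (tlGeo d nf nc m L j kk η R).M := by
    show (0 : ℝ) < m
    exact_mod_cast hm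
  have hδhalf : 0 < 1 / 2 * δ₁ := by linarith
  have hdepth : 1 / (2 * (L : ℝ)) * (m : ℝ) ≤ (m : ℝ) / L - w := depth_interface hLr0 hw
  exact prop23_assembled_fine_twoLevel_cubes (g := (tlGeo d nf nc m L j kk η R)) (ι := Idx d nf nc) (pf := cubeInd m L)
    (hf := hfun nf nc m L) (js := fun _ => j) (n₀ := 2 ^ d + 2 ^ d) (sq := InCube m L) (bsq := InBig m L)
    (Mc := (m : ℝ) / L) (κ := 1 / (2 * (L : ℝ)))
    d (tlGeo_isPseudoDist d nf nc m L j kk η R) (tlGeo_levelSep d nf nc m L j kk η R) hLr hη hM hRM blk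
    (tlGeo_ineq260 d nf nc m L j kk η R hα') (fun a _ => Ktl_nonneg d a) (tlGeo_profile d nf nc m L j kk η R hL2) hα' hsize
    hκδ hB₁ hθ hδ₁.le hsplit (tlGeo_ineq261With d nf nc m L j kk η R hL2 hσ) hthr
    (tlGeo_ineq261With d nf nc m L j kk η R hL2 hδhalf)
    (tlGeo_ineq263With d nf nc m L j kk η R hL2 hδhalf hδ₁.le (by norm_num)) (Ktl_nonneg d _)
    (by positivity) (by positivity) hBX hBC
    (fun y => card_filter_hfun_ne_zero_le hm L y) (cubeInd_zero_or_one m L) (cubeInd_mul_hfun hm L) (sum_hfun_sq hm hL0)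
    (abs_hfun_sub_le hm hL1)
    (fun i y _ => by rcases y with x | i' <;> simp)
    (fun _ _ _ hy hy'' => gap_of_cubeInd_eq_zero hm hL1 hy hy'') hX hXw h281 hCk0 h270 (zone nf nc m L w)
    (zone_nonempty hm hL0 hnf hnc hw0) hχ1 hpfχ hhχ hχN hGD hDG hχGw hGwχ hG hGw hKGw hKG (by positivity)
    (fun _ _ h => inCube_of_cubeInd_ne_zero h) (fun _ _ h => inCube_of_pre_ne_zero hm L (pre_ne_zero_of_hfun_ne_zero h))
    (fun _ _ _ hy hz => collar hL1 hy hz) (fun _ _ hx => mem_zone.mp hx) hdepth hcQ hcQs hQ hQs hQχ hQsh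
    hXdef hXwdef hKM

end Edge

/-! ## §7  The model hypotheses hold together; the interface obstruction is real -/

/-- The side conditions of the two-level model (d ≥ 1, M ≥ 1, n_f, n_c ≥ 5, L ≥ 2, 0 ≤ w, 2wL ≤ M) are jointly
satisfiable — d = 1, M = 4, n_f = n_c = 5, L = 2, w = 1 — and on that instance every cube has a non-empty zone, (2.36)
holds at every site of both levels for the NORMALISED family, while the plain two-level sum is 2 at the interface corner.
[folklore] -/
theorem coverTwoLevel_nonvacuous :
    ∃ d nf nc m L : ℕ, ∃ _ : NeZero d, ∃ w : ℝ, 0 < m ∧ 5 ≤ nf ∧ 5 ≤ nc ∧ 2 ≤ L ∧ 0 ≤ w ∧ 2 * w * L ≤ m ∧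
      (∀ i : Idx d nf nc, (zone nf nc m L w i : Finset (TL d (nf * m) (nc * m))).Nonempty) ∧
      (∀ y : TL d (nf * m) (nc * m), ∑ i : Idx d nf nc, hfun nf nc m L i y ^ 2 = 1) ∧
      sqS nf nc m L (Sum.inl 0 : TL d (nf * m) (nc * m)) = 2 := by
  refine ⟨1, 5, 5, 4, 2, inferInstance, 1, by norm_num, le_rfl, le_rfl, le_rfl, zero_le_one, by norm_num, ?_, ?_, ?_⟩
  · exact fun i => zone_nonempty (by norm_num) two_pos le_rfl le_rfl zero_le_one i
  · exact fun y => sum_hfun_sq (by norm_num) two_pos y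
  · exact sqS_corner_eq_two (by norm_num) (by norm_num)

end Literature.MathematicalPhysics.QuantumFieldTheory.Balaban1983to89.B6CoverTwoLevel
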